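import Literature.MathematicalPhysics.QuantumFieldTheory.Balaban1983to89.B6Ineq268MultiLevelBoxL0
import Literature.MathematicalPhysics.QuantumFieldTheory.Balaban1983to89.B6Prop22AllMultiLevelBoxL0
import Literature.MathematicalPhysics.QuantumFieldTheory.Balaban1983to89.B6Geom246MultiLevelBoxL0
import Literature.MathematicalPhysics.QuantumFieldTheory.Balaban1983to89.B6MultiLevelBoxOperatorL0
import Literature.MathematicalPhysics.QuantumFieldTheory.Balaban1983to89.B8Ineq192MultiLevelBox
/-!
# `Balaban1983to89.B8Ineq192MultiLevelBoxL0` — LEVEL-0 TWIN (programme G-F3′-L0, director-ym LINE №27 / UV3-NODE §24.5; plan `lit-balaban-r03/G-F3L0-PLAN.md`) of `B8Ineq192MultiLevelBox`: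
the same declarations, SAME NAMES AND STATEMENTS, for nested families WITH print's region `Λ₀ = T ∖ Ω₁` ADMITTED (structures
`B6MultiLevelBoxOperatorL0.Domains` / `B6MultiLevelTorusOperatorL0.TDomains`: levels `0, …, k`, the level-`0` block a single site, `Q′₀ = id`,
finite weight `a₀` — print p.225 (2.14) «Σ_{j=0}^k … (Q′₀λ)(x) = λ(x), x ∈ Λ₀», p.229 «taking a sequence (2.1) … smallest possible domains B^j(Λ_j),
and considering the operator Δ_a defined by (2.19), (2.20) for this sequence»).  Every `D`-free object is the lineage's, consumed BY NAME; no existing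
module is touched; no fact is minted.  Unit `lit-balaban-r03` (B6 fold owner, r03 gen 36); referee ref-4.  THE TWIN'S DOCUMENTATION FOLLOWS
VERBATIM (its «levels 1 … k» / «Ω₁ = X» sentences describe the twin; here `j` runs from `0` and `Ω₁` may be a proper subset).

# `Balaban1983to89.B8Ineq192MultiLevelBox` — T. Bałaban, *Spaces of regular gauge field configurations on a lattice and gauge
# fixing conditions*, Commun. Math. Phys. **99** (1985) 75–102 [Balaban1985RegularSpaces], **(1.91)–(1.92)** p. 91
# «|(H′X)(x)|, |(∇H′X)(x)| ≦ B′₀[1, (Lʲη)⁻¹]|X| for x ∈ Ω_j» and the Δ-entry consumed on p. 93, for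
# H′ = G′²Q′\*(Q′G′²Q′\*)⁻¹ **AT THE FLAT BACKGROUND U₀ = 1 ON THE GENUINE `k`-LEVEL NEUMANN-BOX FAMILY OF [B6] §2**
# (an ARBITRARY nested sequence of block-union domains X = Ω₁ ⊃ Ω₂ ⊃ … ⊃ Ω_k with (2.1)–(2.2); the level prefactors
# `[1, (Lʲη)⁻¹, (Lʲη)⁻²]` are now genuine), the inverse `(Q′G′²Q′\*)⁻¹` entering BY ITS TWO PRINTED PROPERTIES

statement-level skeleton of published theorems with citation tags; proofs where landed; nothing here is a claim about the Yang–Mills mass gap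

PDF held: `paper:balaban1985-cmp99-regular-spaces-gauge-fixing` (journal page = PDF page + 74); text layer re-read this generation:
p. 91 [PDF 17] l. 30–34 ((1.91), (1.92) «for x ∈ Ω_j»), p. 92 [PDF 18] l. 2–4 (the display of `(H′X)(x)` and «B′₀ is an absolute
constant (depending on d and L only)»), p. 93 [PDF 19] l. 4 («… and with ΔH′D′(u₁, λ)»); the display (1.92) itself was read as an
image by this seat earlier (module `B8Ineq192FlatTorus`, render `…-p017-x2.png`).

CITATION HEADER (lean-in-tree rule).  Cell `lit-balaban` (HOME `run/shared/lean/pub/lit-balaban/`), unit `lit-balaban-r05` gen 43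
(B8 reader/typer and fold owner; free-target protocol G.5-34(d), TAKING HOME/STATUS 2026-08-22T15:31Z).  WHAT IS REPRODUCED =
SKELETON row **B8.Eq1.91** ((1.91)–(1.92)), member (1.92) and the p. 93 Δ-entry, on the MULTI-LEVEL flat carriers: after the
one-scale torus instance `B8Ineq192FlatTorus` (constant domain sequence, every prefactor `(Lʲη)^{±n} = 1`) this module proves
(1.92) WITH ITS LEVEL PREFACTORS for the GENUINE `k`-level operators of seat p21's [B6] §2 programme on a Neumann box —
`G′ = Δ′_a⁻¹ = B6MultiLevelBoxOperator.gml` for an arbitrary nested family `D : Domains d ℓ M_h k P R` ((2.1)–(2.2) as a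
structure), `Q′\* = B6Ineq268MultiLevelBoxL0.QsB D` (the (2.69)-adjoint of the normalised block average `Q′ = QB D`), the
weights `W(y) = (Lʲη)^{d+1}` of the pairing (2.69) — with the inverse `(Q′G′²Q′\*)⁻¹` of (1.91) entering as an ARGUMENT
`G : Module.End ℝ (𝔅 → ℝ)` carrying exactly the two conclusions that [B6] Proposition 2.3 prints for it and that p21's
`B6Prop23MultiLevelBox.prop23_multiLevelBox` certifies for this family (staged in `lit-balaban-p21/lean/`, filing behind
P3/P4 at the time of writing): the inverse identity `(Q′G′²Q′\*)·G = 1` (`kerOp (W D) (Xk D a) * G = 1`) and the kernel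
bound (2.87) `|G(y, y′)| ≦ C₁(Lʲη)⁻⁴(L^{j′}η)^{−(d+1)}e^{−½δ₁d(y,y′)}` (`|mat G y y′ / W D y′| ≤ …`, VERBATIM the shape of
`prop23_multiLevelBox`).  No `… : Prop` fact is minted (D-0026): the two properties are HYPOTHESES of theorems whose
conclusion is (1.92), the device of `B8Ineq198R.ineq198_R_of_thms3132`; when `prop23_multiLevelBox` is in the tree a
three-line corollary discharges them (successor note in HOME/lit-balaban-r05/HANDOFF.md).  Kind «kernel-checked proof of
a model instance»; three definitions with bodies (`hPrimeML` = (1.91) and `rProjML` = [4] (3.25) on these carriers, the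
(2.69)-kernel `hKer`); every input enters BY NAME; 0 sorry.

WHAT IS PRINTED (verbatim).  p. 91 [PDF 17]: *"Let us introduce the operators H′ = G′²Q′\*(Q′G′²Q′\*)⁻¹, G′ = (Δ + Q′\*aQ′)⁻¹.
(1.91) They were investigated in [4], and the following inequality can be obtained from the results of this paper: |(H′X)(x)|,
|(∇H′X)(x)| ≦ B′₀[1, (Lʲη)⁻¹]|X| for x ∈ Ω_j, (1.92)"*; p. 92 [PDF 18]: *"where (H′X)(x) = Σ_{y′∈𝔅_k}(L^{j′}η)^d H′(x, y′)X(y′),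
and B′₀ is an absolute constant (depending on d and L only)."*; p. 93 [PDF 19] l. 1–4: *"… We get the same bound for the term
with D\*A (but with RD\*A subtracted), and with ΔH′D′(u₁, λ)."* (consumes a bound on ΔH′ of the shape (Lʲη)⁻², `B8Ineq192Op`
§2); p. 96 [PDF 22], (1.115) ⇒ (1.116): the identity «Q′H′ = I».  [B6] = T. Bałaban, *Propagators and renormalization
transformations for lattice gauge theories. II*, CMP **96** (1984) 223–250 [Balaban1984PropagatorsII]: p. 235 [PDF 13] *"Of course
the operator Q′G′²Q′\* is positive definite, so its inverse is well defined"*; Prop. 2.2 (2.67) p. 234, Prop. 2.3 (2.87)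
p. 238 «|(Q′G′²Q′\*)⁻¹(y, y′)| ≦ O(1)(Lʲη)⁻⁴(L^{j′}η)^{−d}e^{−½δ₁d(y,y′)}», Lemma 2.1 (2.60)–(2.61) p. 234, the composition rule
(2.52)–(2.55) p. 232 and the scale sum (2.68) p. 235.

WHAT THIS FILE PROVES (kernel; axioms standard).  Setting of `B6MultiLevelBoxOperator` / `B6Geom246MultiLevelBox` /
`B6Ineq268MultiLevelBox`: fine box `X = Π_μ[0, L^k·L·M_h·P_μ)` in lattice units (η = 1, spatial dimension `d + 1`, `L = ℓ + 1`),
nested family `D`, blocks `𝔅 = bset D`, block map `y(x) = blkOf D x`, lengths `(geom D).len y = L^{j}` for `y ∈ Λ_j`,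
multiscale distance `d = (geom D).dist` (2.46), weights `a_j` in a window with `a_{i+1} = aNext ℓ a_i c_i`.
* §1 **`hPrimeML D a G`** := G′∘G′∘Q′\*∘G — (1.91) with bodies, `G` the argument standing for `(Q′G′²Q′\*)⁻¹`;
  **`QB_comp_hPrimeML`: Q′H′ = 1** from `(Q′G′²Q′\*)G = 1` («Q′H′ = I», p. 96); the (2.69)-kernel **`hKer`** with p. 92's display
  **`hPrimeML_eq_sum`: (H′X)(x) = Σ_{y′∈𝔅}(L^{j′}η)^{d+1}H′(x, y′)X(y′)**.
* §2 (engine, abstract `g : B6.Geometry`, [B6] (2.52)–(2.55), (2.60), (2.61)) `abs_apply_le_of_levelBound` (a majorant applied to a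
  level-weighted input through the block decomposition Σ_yΔ(y) = I), `pow_len_le_of_levelSep` (THE SCALE ABSORPTION
  «using the exponential factor … and the estimate (2.60)», p. 235: `(Lʲη)ⁿ ≦ Lⁿe^{βd(y,y′)}(L^{j′}η)ⁿ` once `Lⁿ ≦ e^{βRM}`),
  `ineq261With_of_le` ((2.61) is monotone in the rate), `levelConv_le` / `levelRowSum_le` (the 𝔅-convolution / row sum of
  decaying kernels against a level weight: (2.54) + (2.60) + (2.61)).
* §3 `hasMajorant_comp`: for the genuine `G′` — a left factor with Prop.-2.2 majorant `C·p(y)·e^{−½δ₀d}` composed with `G′`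
  (majorant `C(Lʲη)²e^{−½δ₀d}`) has majorant `C²L²c·p(y)(Lʲη)²·e^{−¼δ₀d}` (the scale sum of (2.68) for the pair).
* §4 **`hPrime_single_decay_of_inverse`** — **THE KERNEL OF (1.91) DECAYS, WITH THE LEVEL PREFACTORS** (the operator form
  «H′ ≺ κ_He^{−ρd}, ∇H′ ≺ κ_H(Lʲη)⁻¹e^{−ρd}, ΔH′ ≺ κ_H(Lʲη)⁻²e^{−ρd}» of `B8Ineq192Op.ineq192_op`, now for GENUINE operators): for
  every `C₁, δ₁ > 0` there are `ρ, B, M₀ > 0`, `N₀ ≥ 1` (functions of `d, ℓ`, the weight windows, `C₁, δ₁`) such that for every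
  `k`, `M_h ≥ 3` with `L·M_h ≥ M₀`, `R ≥ 2L` with `R·L·M_h ≥ N₀ + 1`, every box `P`, every nested family `D` with (2.1)–(2.2),
  every windowed weight sequence, EVERY operator `G` on `𝔅` with the (2.87)-bound (constants `C₁, δ₁`), every `y′ ∈ 𝔅` and
  every fine point `x` (in `B^j(Λ_j)`, `j = D.lev x`, block `y(x)`): `|(H′δ_{y′})(x)| ≦ Be^{−ρd(y(x),y′)}`,
  `|(∂_μH′δ_{y′})(x)| ≦ B(Lʲ)⁻¹e^{−ρd(y(x),y′)}` (every axis μ; `∂_μ = B6Prop22DerivMultiLevelBox.dMat`, the forward unit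
  difference = `∇^η` in lattice units), `|((−Δ^N)H′δ_{y′})(x)| ≦ B(Lʲ)⁻²e^{−ρd(y(x),y′)}` (`−Δ^N = opBoxR 1 0 0 1`, the
  Neumann Laplacian of the box); `hKer_decay_of_inverse`: `|H′(x, y′)| ≦ B(L^{j′})^{−(d+1)}e^{−ρd(y(x),y′)}`.  Mechanism =
  the paper's «obtained from the results of [4]» at the flat background, [4] ↦ [B6] §2: Prop. 2.2 entries 1, 2, 6 for the
  genuine `G′` (`B6Prop22AllMultiLevelBoxL0.prop22_entries1236_multiLevelBox`, p21) composed with `G′` once more (§3), then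
  applied to the (2.87)-column `z ↦ G(y(z), y′)` of `Q′\*G`, the weight `(L^{j(z)})⁻⁴` moved to the point `x` by (2.60) (§2),
  the middle point summed by (2.61), the end-to-end rate by (2.54) (`B6Geom246MultiLevelBoxL0.lemma21_box`,
  `B6Ineq268MultiLevelBoxL0.levelSepB`, `levelConv_le`).
* §5 **`ineq192_multiLevelBox_of_inverse`** — **(1.92) AT U₀ = 1 ON THE `k`-LEVEL BOX FAMILY**: with `B′₀, M₀, N₀` as above, for
  every `X : 𝔅 → ℝ` with `|X(y′)| ≦ S` and every fine point `x` at its level `j`: `|(H′X)(x)| ≦ B′₀S`,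
  `|(∂_μH′X)(x)| ≦ B′₀(Lʲ)⁻¹S`, and the p. 93 entry `|((−Δ^N)H′X)(x)| ≦ B′₀(Lʲ)⁻²S` — uniformly in `k`, the box and the family
  — from §4 through p. 92's display and the row sum (2.61); `ineq192_multiLevelBox_supNorm` (the same with
  `|X| = max_{y′}|X(y′)|`); `QB_hPrimeML` (Q′(H′X) = X under the inverse identity).
* §6 **`rProjML D a G`** := 1 − G′Q′\*·G·Q′G′ — [4] (3.25) «Rf = (I − G′Q′\*(Q′G′²Q′\*)⁻¹Q′G′)f» (= [B5] (1.44)), B8's `R(U₀)`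
  (1.27) at U₀ = 1, on these carriers; `QB_gml_rProjML` (Q′G′R = 0: Ran R ⊂ Δ′_aN(Q′)), `rProjML_gml_QsB` (R·G′Q′\* = 0),
  `rProjML_idem` (R² = R) from the two inverse identities; `abs_QB_le` (|Q′g| ≦ max|g| blockwise);
  **`rProjML_sup_bound_of_inverse`** — B8 p. 92 «from Theorems 3.1, 3.2 of [4] it follows that |Rf| ≦ B′₀|f|» (row B8.Claim@92)
  AT U₀ = 1 ON THE `k`-LEVEL BOX FAMILY: `|(Rf)(x)| ≦ B′₀|f|`, every level weight genuine (`(Lʲ)²` of G′, `(Lʲ)⁻⁴` of (2.87),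
  two scale absorptions by (2.60)).

HONEST SCOPE / NOT CLAIMED.  (i) `(Q′G′²Q′\*)⁻¹` is NOT constructed here: it is the argument `G`, constrained by the two
printed properties; the theorems are therefore CONDITIONAL on an inhabitant — supplied for this very family by p21's
`prop23_multiLevelBox` (kernel-checked in p21's folder, not yet in the tree when this file was written); until then the value
is the algebra-and-bounds half of (1.91)–(1.92) on genuine multi-level carriers (cell interface need I-B8-2 / IF-A-01 at
U₀ = 1).  (ii) Neumann box in place of the torus `T_η`, levels `1 … k` with `Ω₁ = X`, `A = 0` (no gauge field: U₀ = 1),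
scalar fibre, lattice units (`Lʲ` for «Lʲη») — exactly the scope of the [B6] `k`-level chain; `x ∈ Ω_j` is read at the
point's own level `j = D.lev x` (for `x ∈ Ω_i`, `i ≤ j`, the printed `(Lⁱη)⁻¹ ≥ (Lʲη)⁻¹` is weaker); `|X|` = the sup norm
over `𝔅`; the pairing weight is `(L^{j′}η)^{d+1}` (spatial dimension `d + 1`).  (iii) Constants existential and crude
(functions of `d, ℓ`, the windows and `C₁, δ₁`; print: «depending on d and L only» at the series' fixed `a`); the (2.61)
constant is the `L`-dependent `K261` of `B6Ineq261LevelGap` (the printed `c₁(α)` is refuted as typed, GAPS G-A11-1); «M, RM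
sufficiently large» are the explicit thresholds `M₀`, `N₀`.  (iv) The general (1.92) — a background `U₀ ∈ 𝔄_k` with (3.35)
of [4] — stays the typed leaf of `B8Ineq192` / `B8Ineq192Op` ([4] Thms 3.1–3.3 are not in the tree as theorems); rows
B8.Eq1.91 / B8.Claim@92: heads NOT changed by this file (owner's word).  (v) NOT summit progress, NOT continuum, NOT Clay.

RELATED IN THE TREE, NOT DUPLICATED (stem check 2026-08-22T15:28Z: `ls Balaban1983to89 | grep -i 192` = `B15Claim192Flow`,
`B8Ineq192`, `B8Ineq192FlatTorus`, `B8Ineq192GaugeInv`, `B8Ineq192Op`; no multi-level instance): `B8Ineq192FlatTorus` (one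
scale, hypothesis-free, tower-torus lineage), `B8Ineq192`/`B8Ineq192Op` ([4]-shaped letters), `B8Eq191Hprime` ((1.91) on the
ℓ²/(3.25) carriers), `B6Ineq268MultiLevelBox` … `B6Ineq281MultiLevelBox` (p21's `k`-level Prop. 2.3 programme, consumed by
name), `B6MainResultsOneLevel` (r03: the operator H = GQ\*(QGQ\*)⁻¹ of [B6] Prop. 2.6 on one level — not H′).
-/

namespace Literature.MathematicalPhysics.QuantumFieldTheory.Balaban1983to89.B8Ineq192MultiLevelBoxL0

open Finset Matrix
open B4Reflection242 (boxDom)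
open B4BoxCov237 (opBoxR)
open B6MultiLevelBoxOperator hiding Domains mlOp_apply
open B6MultiLevelBoxOperatorL0
open B6Geom246MultiLevelBox hiding Touch blkOf blkOf_corner blkOf_eq_iff_blk blkOf_eq_of_blk_i_eq blkOf_val bond bond_adj bset cen connected coord_bounds corner corner_mem csys dist_blkOf_le_box dist_blkOf_le_coord dist_blkOf_le_line dist_cen_le_of_adj dist_cen_le_of_touch dist_le_one_of_near dist_toR_cen_le exists_blkOf_eq geom lemma21_box lev_corner lev_eq_of_blkOf_eq levelGap pack reachable_blkOf reachable_of_near realizes scale_bounds touch_symm triangle_refl_nonneg walk_disp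
open B6Geom246MultiLevelBoxL0
open B6Ineq268MultiLevelBox hiding QB QB_apply QsB QsB_apply W W_eq W_pos Xk abs_qB abs_qB_le card_blkOf_le csysB geomB geomB_L geomB_M geomB_R geomB_RM geomB_RM_nonneg geomB_Site geomB_dist geomB_eta geomB_len geom_len ineq268_multiLevelBox instDecidableEqGeomBSite kerOp_Xk levelSepB qB qB_ne_zero realizesB refl_nonnegB sum_abs_qB_le symmB triangleB
open B6Ineq268MultiLevelBoxL0
open B6Prop22DerivMultiLevelBox (dMat)
open B6Prop22AllMultiLevelBoxL0 (prop22_entries1236_multiLevelBox)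
open B6RandomWalk (HasMajorant BlockSupp Triangle254 hasMajorant_mul hasMajorant_mono blockPiece sum_blockPiece
  blockSupp_blockPiece)
open B6Ineq268 (LevelSep Symm mx mx_eq_of_lt' dist_nonneg_of_levelSep)
open B6Lemma21Repaired (Ineq261With)
open B6Ineq261LevelGap (K261 K261_nonneg theta_lt_one_of_log)
open B6Ineq243TwoLevelBox (aNext)
open B6Expansion282 (kerOp)
open B6Prop23Chain (mat apply_eq_sum_mat)
open Literature.MathematicalPhysics.QuantumFieldTheory.Balaban1983to89.B8Ineq192MultiLevelBox (abs_apply_le_of_levelBound pow_len_le_of_levelSep ineq261With_of_le levelConv_le levelRowSum_le abs_sum_mul_le_of_decay)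

noncomputable section

variable {d : ℕ}

/-! ## §1  (1.91) on the `k`-level box family: `H′ = G′²Q′*·G`, `G` standing for `(Q′G′²Q′*)⁻¹`; «Q′H′ = I»; the kernel -/

section HPrime

variable {ℓ Mh k R : ℕ} {P : Fin (d + 1) → ℕ} (D : Domains d ℓ Mh k P R) (a : ℕ → ℝ)

/-- **(1.91) at U₀ = 1 on the `k`-level Neumann-box family**: `H′ = G′·G′·Q′*·G : (𝔅 → ℝ) →ₗ (X → ℝ)` with the GENUINE
`G′ = Δ′_a⁻¹ = gml` (the `k`-level operator (2.13)–(2.14) of [B6] inverted), `Q′* = QsB D` (the (2.69)-adjoint of the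
normalised block average), and `G` an operator on `𝔅` standing for `(Q′G′²Q′*)⁻¹` («positive definite, so its inverse is
well defined»). [cite: Balaban1985RegularSpaces, (1.91) p.91; Balaban1984PropagatorsII, p.235] -/
def hPrimeML (G : Module.End ℝ (↥(bset D) → ℝ)) : (↥(bset D) → ℝ) →ₗ[ℝ] (↥(boxDom (N0 ℓ Mh k P)) → ℝ) :=
  Matrix.toLin' (gml (N0 ℓ Mh k P) ℓ k D.lev a) ∘ₗ Matrix.toLin' (gml (N0 ℓ Mh k P) ℓ k D.lev a) ∘ₗ QsB D ∘ₗ G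

/-- **The (2.69)-kernel of (1.91)**: `H′(x, y′) = (H′δ_{y′})(x)/(L^{j′}η)^{d+1}`, so that p. 92's display
`(H′X)(x) = Σ_{y′∈𝔅}(L^{j′}η)^{d+1}H′(x, y′)X(y′)` holds (`hPrimeML_eq_sum`). [cite: Balaban1985RegularSpaces, p.92 (the display after (1.92)); Balaban1984PropagatorsII, (2.69) p.235] -/
def hKer (G : Module.End ℝ (↥(bset D) → ℝ)) (x : ↥(boxDom (N0 ℓ Mh k P))) (y' : ↥(bset D)) : ℝ :=
  hPrimeML D a G (Pi.single y' 1) x / W D y'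

variable {D a}

/-- the letters of (1.91) applied in turn: `H′X = G′(G′(Q′*(GX)))`. [cite: Balaban1985RegularSpaces, (1.91) p.91] -/
theorem hPrimeML_apply (G : Module.End ℝ (↥(bset D) → ℝ)) (X : ↥(bset D) → ℝ) :
    hPrimeML D a G X =
      gml (N0 ℓ Mh k P) ℓ k D.lev a *ᵥ (gml (N0 ℓ Mh k P) ℓ k D.lev a *ᵥ QsB D (G X)) := by
  simp only [hPrimeML, LinearMap.comp_apply, Matrix.toLin'_apply]

/-- **«Q′H′ = I»** (p. 96, the step (1.115) ⇒ (1.116)): if `G` inverts `Q′G′²Q′*` on the right — `(Q′G′²Q′*)·G = 1`, the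
second identity of [B6] Prop. 2.3 for this family (`kerOp (W D) (Xk D a)` IS `Q′G′²Q′*`, `B6Ineq268MultiLevelBoxL0.kerOp_Xk`) —
then `Q′ ∘ H′ = id` on `𝔅 → ℝ`. [cite: Balaban1985RegularSpaces, (1.115)–(1.116) p.96; Balaban1984PropagatorsII, p.235] -/
theorem QB_comp_hPrimeML {G : Module.End ℝ (↥(bset D) → ℝ)} (hG : kerOp (W D) (Xk D a) * G = 1) :
    QB D ∘ₗ hPrimeML D a G = LinearMap.id := by
  rw [kerOp_Xk, Module.End.mul_eq_comp, Module.End.one_eq_id] at hG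
  simpa only [hPrimeML, LinearMap.comp_assoc] using hG

/-- hence `Q′(H′X) = X` for every coarse function `X`. [cite: Balaban1985RegularSpaces, (1.115)–(1.116) p.96] -/
theorem QB_hPrimeML {G : Module.End ℝ (↥(bset D) → ℝ)} (hG : kerOp (W D) (Xk D a) * G = 1) (X : ↥(bset D) → ℝ) :
    QB D (hPrimeML D a G X) = X := by
  have h := congrArg (fun T : (↥(bset D) → ℝ) →ₗ[ℝ] (↥(bset D) → ℝ) => T X) (QB_comp_hPrimeML hG)
  simpa only [LinearMap.comp_apply, LinearMap.id_apply] using h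

/-- expansion of a coarse function in point masses under a linear map to fine-lattice functions:
`(ΦX)(x) = Σ_{y′}(Φδ_{y′})(x)·X(y′)`. [folklore] -/
private theorem apply_eq_sum_single {ι Y : Type} [Fintype ι] [DecidableEq ι] (Φ : (ι → ℝ) →ₗ[ℝ] (Y → ℝ)) (X : ι → ℝ)
    (x : Y) : Φ X x = ∑ y' : ι, Φ (Pi.single y' 1) x * X y' := by
  have hdec : X = ∑ y' : ι, X y' • (Pi.single y' (1 : ℝ) : ι → ℝ) := by
    funext z
    rw [Finset.sum_apply]
    simp [Pi.single_apply]
  conv_lhs => rw [hdec, map_sum, Finset.sum_apply]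
  refine Finset.sum_congr rfl fun y' _ => ?_
  rw [map_smul, Pi.smul_apply, smul_eq_mul, mul_comm]

/-- **p. 92's display: `(H′X)(x) = Σ_{y′∈𝔅}(L^{j′}η)^{d+1}H′(x, y′)X(y′)`** (the (2.69) convention for kernels on `𝔅`).
[cite: Balaban1985RegularSpaces, p.92; Balaban1984PropagatorsII, (2.69) p.235] -/
theorem hPrimeML_eq_sum (G : Module.End ℝ (↥(bset D) → ℝ)) (X : ↥(bset D) → ℝ) (x : ↥(boxDom (N0 ℓ Mh k P))) :
    hPrimeML D a G X x = ∑ y' : ↥(bset D), W D y' * hKer D a G x y' * X y' := by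
  rw [apply_eq_sum_single]
  refine Finset.sum_congr rfl fun y' _ => ?_
  unfold hKer
  rw [mul_div_cancel₀ _ (W_pos D y').ne']

/-- the same for a fine-lattice operator applied after `H′` (used for `∂_μH′`, `ΔH′`):
`(T·H′X)(x) = Σ_{y′}(T·H′δ_{y′})(x)·X(y′)`. [cite: Balaban1985RegularSpaces, p.92; Balaban1984PropagatorsII, (2.69) p.235] -/
theorem mulVec_hPrimeML_eq_sum (T : Matrix ↥(boxDom (N0 ℓ Mh k P)) ↥(boxDom (N0 ℓ Mh k P)) ℝ)
    (G : Module.End ℝ (↥(bset D) → ℝ)) (X : ↥(bset D) → ℝ) (x : ↥(boxDom (N0 ℓ Mh k P))) :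
    (T *ᵥ hPrimeML D a G X) x = ∑ y' : ↥(bset D), (T *ᵥ hPrimeML D a G (Pi.single y' 1)) x * X y' := by
  have h := apply_eq_sum_single (Matrix.toLin' T ∘ₗ hPrimeML D a G) X x
  simpa only [LinearMap.comp_apply, Matrix.toLin'_apply] using h

/-- `Q′*(Gδ_{y′})` is the column `z ↦ G(y(z), y′)` of the matrix of `G` (block-constant extension, `QsB_apply`).
[cite: Balaban1984PropagatorsII, (2.69) p.235, p.248 («Q*»)] -/
theorem QsB_single_apply (G : Module.End ℝ (↥(B6Geom246MultiLevelBoxL0.bset D) → ℝ)) (y' : ↥(bset D)) (z : ↥(boxDom (N0 ℓ Mh k P))) :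
    QsB D (G (Pi.single y' 1)) z = mat G (blkOf D z) y' := by
  rw [QsB_apply]; rfl

end HPrime

/-! ## §2  Engine on an abstract geometry: block decomposition, scale absorption (2.60), row sums (2.61) -/

section Engine

variable {g : B6.Geometry} {X : Type}

end Engine

/-! ## §3  On the box: lengths, the scale absorption for the realised geometry, the composite majorants with `G′` -/

section Box

variable {ℓ Mh k R : ℕ} {P : Fin (d + 1) → ℕ} (D : Domains d ℓ Mh k P R)

/-- `Lʲη = Lʲ > 0` on the box geometry. [cite: Balaban1984PropagatorsII, (2.1) p.224, dictionary] -/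
theorem len_pos (y : ↥(B6Geom246MultiLevelBoxL0.bset D)) : 0 < (geom D).len y := by
  rw [geom_len, mul_one]; positivity

/-- `Lʲη = Lʲ` with `j` the level of the block. [cite: Balaban1984PropagatorsII, (2.1) p.224, dictionary] -/
theorem len_eq (y : ↥(B6Geom246MultiLevelBoxL0.bset D)) : (geom D).len y = ((ℓ : ℝ) + 1) ^ y.1.1 := by
  rw [geom_len, mul_one]

/-- the length at the block of a site: `L^{lev x}`. [cite: Balaban1984PropagatorsII, p.231 («x ∈ B^j(y)»), dictionary] -/
theorem len_blkOf (x : ↥(boxDom (N0 ℓ Mh k P))) : (B6Geom246MultiLevelBoxL0.geom D).len (blkOf D x) = ((ℓ : ℝ) + 1) ^ D.lev x.1 := by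
  rw [len_eq]; rfl

variable {D}

/-- **THE SCALE ABSORPTION ON THE BOX** for an inverse power: `(L^{j″})⁻ⁿ ≦ Lⁿe^{βd(y,y″)}(L^{j})⁻ⁿ` under (2.60)
(`levelSepB`) and `Lⁿ ≦ e^{β(RM−1)}`. [cite: Balaban1984PropagatorsII, (2.60) p.234, p.235] -/
theorem inv_pow_len_le (hMh : 1 ≤ Mh) (hP : ∀ μ, 1 ≤ P μ) (hRM : 1 ≤ R * ((ℓ + 1) * Mh)) (n : ℕ) {β : ℝ}
    (hβ : 0 ≤ β) (hthr : ((ℓ : ℝ) + 1) ^ n ≤ Real.exp (β * ((B6Ineq268MultiLevelBoxL0.geomB D).R * (geomB D).M))) (y y'' : ↥(bset D)) :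
    ((geom D).len y'' ^ n)⁻¹ ≤ ((ℓ : ℝ) + 1) ^ n * Real.exp (β * (geom D).dist y y'') * ((geom D).len y ^ n)⁻¹ := by
  have hL1 : (1 : ℝ) ≤ (geomB D).L := by rw [geomB_L]; linarith [(Nat.cast_nonneg ℓ : (0 : ℝ) ≤ ℓ)]
  have hη : (0 : ℝ) ≤ (geomB D).eta := by rw [geomB_eta]; exact zero_le_one
  have h := pow_len_le_of_levelSep (g := geomB D) (levelSepB D hMh hP hRM) (geomB_RM_nonneg D hMh hRM) hL1 hη n hβ
    (by rw [geomB_L]; exact hthr) y y''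
  change (geom D).len y ^ n ≤ ((ℓ : ℝ) + 1) ^ n * Real.exp (β * (geom D).dist y y'') * (geom D).len y'' ^ n at h
  have hy : 0 < (geom D).len y ^ n := pow_pos (len_pos D y) n
  have hy'' : 0 < (geom D).len y'' ^ n := pow_pos (len_pos D y'') n
  rw [← div_eq_mul_inv, le_div_iff₀ hy, inv_mul_eq_div, div_le_iff₀ hy'']
  exact h

/-- … and for a positive power, in the orientation of a 𝔅-convolution: `(L^{j″})ⁿ ≦ Lⁿe^{βd(y,y″)}(L^{j})ⁿ` (symmetry of `d`,
`symmB`). [cite: Balaban1984PropagatorsII, (2.60) p.234, p.235, (2.46) p.231] -/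
theorem pow_len_le (hMh : 1 ≤ Mh) (hP : ∀ μ, 1 ≤ P μ) (hRM : 1 ≤ R * ((ℓ + 1) * Mh)) (n : ℕ) {β : ℝ}
    (hβ : 0 ≤ β) (hthr : ((ℓ : ℝ) + 1) ^ n ≤ Real.exp (β * ((B6Ineq268MultiLevelBoxL0.geomB D).R * (geomB D).M))) (y y'' : ↥(bset D)) :
    (geom D).len y'' ^ n ≤ ((ℓ : ℝ) + 1) ^ n * Real.exp (β * (geom D).dist y y'') * (geom D).len y ^ n := by
  have hL1 : (1 : ℝ) ≤ (geomB D).L := by rw [geomB_L]; linarith [(Nat.cast_nonneg ℓ : (0 : ℝ) ≤ ℓ)]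
  have hη : (0 : ℝ) ≤ (geomB D).eta := by rw [geomB_eta]; exact zero_le_one
  have h := pow_len_le_of_levelSep (g := geomB D) (levelSepB D hMh hP hRM) (geomB_RM_nonneg D hMh hRM) hL1 hη n hβ
    (by rw [geomB_L]; exact hthr) y'' y
  have hs : (geom D).dist y y'' = (geom D).dist y'' y := symmB D y y''
  change (geom D).len y'' ^ n ≤ ((ℓ : ℝ) + 1) ^ n * Real.exp (β * (geom D).dist y'' y) * (geom D).len y ^ n at h
  rw [hs]
  exact h

/-- **THE COMPOSITE MAJORANT WITH `G′`** (the scale sum of (2.68) for one pair of factors): if `T` has the Prop.-2.2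
majorant `C·p(y)·e^{−½δ₀d(y,y′)}` (`p ≥ 0` a level prefactor) and `T_G` the first-entry majorant `C(Lʲ)²e^{−½δ₀d(y,y′)}`,
and the row sums at the rate `⅛δ₀` are `≦ c`, `L² ≦ e^{⅛δ₀(RM−1)}`, then `T·T_G` has majorant
`C²L²c·p(y)(Lʲ)²·e^{−¼δ₀d(y,y′)}` — (2.52)–(2.55) for the pair, the weight `(L^{j″})²` moved to `y` by (2.60), the middle
point summed by (2.61), the end-to-end rate by (2.54). [cite: Balaban1984PropagatorsII, (2.68) p.235, (2.52)–(2.55) p.232, Lemma 2.1 (2.60)–(2.61) p.234] -/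
theorem hasMajorant_comp (hMh : 1 ≤ Mh) (hP : ∀ μ, 1 ≤ P μ) (hRM : 1 ≤ R * ((ℓ + 1) * Mh))
    {T TG : Module.End ℝ (↥(boxDom (N0 ℓ Mh k P)) → ℝ)} {C δ₀ c : ℝ} (hC : 0 ≤ C) (hδ₀ : 0 < δ₀)
    {p : ↥(B6Geom246MultiLevelBoxL0.bset D) → ℝ} (hp : ∀ y, 0 ≤ p y)
    (hT : HasMajorant (g := geom D) (blkOf D) T
      (fun y y' => C * p y * Real.exp (-(δ₀ / 2 * (geom D).dist y y'))))
    (hTG : HasMajorant (g := geom D) (blkOf D) TG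
      (fun y y' => C * (geom D).len y ^ 2 * Real.exp (-(δ₀ / 2 * (geom D).dist y y'))))
    (h261 : ∀ y : (geom D).Site, ∑ y'' : (geom D).Site, Real.exp (-(δ₀ / 8 * (geom D).dist y y'')) ≤ c)
    (hthr : ((ℓ : ℝ) + 1) ^ 2 ≤ Real.exp (δ₀ / 8 * ((geomB D).R * (geomB D).M))) :
    HasMajorant (g := geom D) (blkOf D) (T * TG)
      (fun y y' => C ^ 2 * (((ℓ : ℝ) + 1) ^ 2 * c) * (p y * (geom D).len y ^ 2) *
        Real.exp (-(δ₀ / 4 * (geom D).dist y y'))) := by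
  have htri := (triangle_refl_nonneg D hMh hP).1
  have hdnn := (triangle_refl_nonneg D hMh hP).2.2
  have hlen0 : ∀ y : ↥(bset D), 0 ≤ (geom D).len y := fun y => (len_pos D y).le
  have hf : ∀ y y'' : (geom D).Site, (geom D).len y'' ^ 2 ≤
      ((ℓ : ℝ) + 1) ^ 2 * Real.exp (δ₀ / 8 * (geom D).dist y y'') * (geom D).len y ^ 2 :=
    fun y y'' => pow_len_le hMh hP hRM 2 (by positivity) hthr y y''
  refine hasMajorant_mono (g := geom D) (blkOf D)
    (hasMajorant_mul (g := geom D) (blkOf D) hT hTG fun a b => ?_) fun a b => ?_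
  · exact mul_nonneg (mul_nonneg hC (pow_nonneg (hlen0 a) 2)) (Real.exp_nonneg _)
  · have hconv := levelConv_le (g := geom D) htri hdnn (σ₁ := δ₀ / 2) (σ₂ := δ₀ / 2) (β := δ₀ / 8) (ρ := δ₀ / 4)
      (τ := δ₀ / 8) (A := ((ℓ : ℝ) + 1) ^ 2) (c := c) (by positivity) (by linarith) (by linarith) (by positivity)
      (f := fun y => (geom D).len y ^ 2) (fun y => pow_nonneg (hlen0 y) 2) hf h261 a b
    have hpa : 0 ≤ C ^ 2 * p a := mul_nonneg (pow_nonneg hC 2) (hp a)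
    calc ∑ y'' : (geom D).Site, C * p a * Real.exp (-(δ₀ / 2 * (geom D).dist a y'')) *
          (C * (geom D).len y'' ^ 2 * Real.exp (-(δ₀ / 2 * (geom D).dist y'' b)))
        = C ^ 2 * p a * ∑ y'' : (geom D).Site, Real.exp (-(δ₀ / 2 * (geom D).dist a y'')) *
            (geom D).len y'' ^ 2 * Real.exp (-(δ₀ / 2 * (geom D).dist y'' b)) := by
          rw [Finset.mul_sum]
          exact Finset.sum_congr rfl fun y'' _ => by ring
      _ ≤ C ^ 2 * p a * (((ℓ : ℝ) + 1) ^ 2 * c * (geom D).len a ^ 2 *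
            Real.exp (-(δ₀ / 4 * (geom D).dist a b))) := mul_le_mul_of_nonneg_left hconv hpa
      _ = C ^ 2 * (((ℓ : ℝ) + 1) ^ 2 * c) * (p a * (geom D).len a ^ 2) *
            Real.exp (-(δ₀ / 4 * (geom D).dist a b)) := by ring

end Box

/-! ## §4  The decaying kernel of (1.91) at U₀ = 1 on the `k`-level box family («H′ ≺ κ_He^{−ρd}» with the level prefactors) -/

section Kernel

/-- a negative real power of a positive length is the inverse of the natural power. [folklore] -/
private theorem rpow_neg_natCast_eq {x : ℝ} (hx : 0 < x) (n : ℕ) : x ^ (-(n : ℝ)) = (x ^ n)⁻¹ := by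
  rw [Real.rpow_neg hx.le, Real.rpow_natCast]

/-- the same for the printed exponent `−4`. [folklore] -/
private theorem rpow_neg_four_eq {x : ℝ} (hx : 0 < x) : x ^ (-(4 : ℝ)) = (x ^ 4)⁻¹ := by
  rw [show (-(4 : ℝ)) = -((4 : ℕ) : ℝ) by norm_num]
  exact rpow_neg_natCast_eq hx 4

/-- **THE KERNEL OF (1.91) AT U₀ = 1 ON THE `k`-LEVEL NEUMANN-BOX FAMILY DECAYS, WITH THE LEVEL PREFACTORS `[1, (Lʲ)⁻¹, (Lʲ)⁻²]`**
(the operator form «H′ ≺ κ_He^{−ρd}, ∇H′ ≺ κ_H(Lʲη)⁻¹e^{−ρd}, ΔH′ ≺ κ_H(Lʲη)⁻²e^{−ρd}» of `B8Ineq192Op.ineq192_op`, now for the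
GENUINE `G′`, `Q′*` of [B6] §2, the inverse `(Q′G′²Q′*)⁻¹` entering by its printed (2.87)-bound): for every `C₁, δ₁ > 0` there are
`ρ, B > 0`, `M₀ > 0`, `N₀ ≥ 1` (functions of `d`, `ℓ`, the weight windows, `C₁`, `δ₁`) such that for every number of levels `k`,
every `M_h ≥ 3` with `L·M_h ≥ M₀`, every `R ≥ 2L` with `R·L·M_h ≥ N₀ + 1`, every box `P`, every nested family `D` of block-union
domains with (2.1)–(2.2), every weight sequence in the windows with `a_{i+1} = aNext ℓ a_i c_i`, EVERY operator `G` on `𝔅` with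
`|G(y, y′)| ≦ C₁(Lʲ)⁻⁴(L^{j′})^{−(d+1)}e^{−½δ₁d(y,y′)}` (the printed bound (2.87) of [B6] Prop. 2.3 for `(Q′G′²Q′*)⁻¹`, in the
(2.69) convention `G(y, y′) = mat G y y′ / W(y′)`), every block `y′ ∈ 𝔅` and every fine point `x` of the box at its level
`j = D.lev x` (`x ∈ B^j(Λ_j) ⊂ Ω_j`), with `d(·,·)` the multiscale distance (2.46) from the block of `x`:
`|(H′δ_{y′})(x)| ≦ Be^{−ρd(y(x),y′)}`, `|(∂_μH′δ_{y′})(x)| ≦ B(Lʲ)⁻¹e^{−ρd(y(x),y′)}` (every axis), `|((−Δ^N)H′δ_{y′})(x)| ≦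
B(Lʲ)⁻²e^{−ρd(y(x),y′)}` — for `H′ = G′²Q′*G` (`hPrimeML`).  Mechanism: [B6] Prop. 2.2 entries 1, 2, 6 for the genuine `G′`
(`prop22_entries1236_multiLevelBox`) composed with `G′` (§3), then applied to the column `z ↦ G(y(z), y′)` of `Q′*G` (the weight
`(L^{j(z)})⁻⁴` moved to `x` by (2.60), the middle point summed by (2.61), the end-to-end rate by (2.54): `levelConv_le`).
[cite: Balaban1985RegularSpaces, (1.91)–(1.92) pp.91–92, p.93 l.1–4; Balaban1984PropagatorsII, Prop. 2.2 (2.67) p.234, Prop. 2.3 (2.87) p.238, Lemma 2.1 (2.60)–(2.61) p.234, (2.52)–(2.55) p.232, (2.68) p.235] -/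
theorem hPrime_single_decay_of_inverse (d ℓ : ℕ) (hℓ : 1 ≤ ℓ) (aminus aplus a2minus a2plus : ℝ) (ha : 0 < aminus)
    (ha2 : 0 < a2minus) {C₁ δ₁ : ℝ} (hC₁ : 0 < C₁) (hδ₁ : 0 < δ₁) :
    ∃ ρ B M₀ : ℝ, ∃ N₀ : ℕ, 0 < ρ ∧ 0 < B ∧ 0 < M₀ ∧ 0 < N₀ ∧
      ∀ (k Mh R : ℕ), 3 ≤ Mh → M₀ ≤ ((ℓ : ℝ) + 1) * Mh → 2 * (ℓ + 1) ≤ R → N₀ + 1 ≤ R * ((ℓ + 1) * Mh) →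
      ∀ (P : Fin (d + 1) → ℕ) (_hP : ∀ μ, 1 ≤ P μ) (D : Domains d ℓ Mh k P R) (a c : ℕ → ℝ),
        (∀ i, aminus ≤ a i ∧ a i ≤ aplus) → (∀ i, a2minus ≤ c i ∧ c i ≤ a2plus) →
        (∀ i, a (i + 1) = aNext ℓ (a i) (c i)) →
        ∀ G : Module.End ℝ (↥(bset D) → ℝ),
          (∀ y y' : ↥(bset D), |mat G y y' / W D y'| ≤
            C₁ * (geom D).len y ^ (-(4 : ℝ)) * (geom D).len y' ^ (-((d + 1 : ℕ) : ℝ)) *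
              Real.exp (-(δ₁ / 2 * (geom D).dist y y'))) →
          ∀ (x : ↥(boxDom (N0 ℓ Mh k P))) (y' : ↥(bset D)),
            |hPrimeML D a G (Pi.single y' 1) x| ≤ B * Real.exp (-(ρ * (geom D).dist (blkOf D x) y')) ∧
            (∀ μ : Fin (d + 1), |(dMat (N0 ℓ Mh k P) μ *ᵥ hPrimeML D a G (Pi.single y' 1)) x| ≤
              B * (((ℓ : ℝ) + 1) ^ D.lev x.1)⁻¹ * Real.exp (-(ρ * (geom D).dist (blkOf D x) y'))) ∧
            |(opBoxR 1 0 0 1 (N0 ℓ Mh k P) *ᵥ hPrimeML D a G (Pi.single y' 1)) x| ≤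
              B * ((((ℓ : ℝ) + 1) ^ D.lev x.1) ^ 2)⁻¹ * Real.exp (-(ρ * (geom D).dist (blkOf D x) y')) := by
  obtain ⟨δ₀, C, M₀, N₀, hδ₀, hC, hM₀, hN₀, h22⟩ :=
    prop22_entries1236_multiLevelBox d ℓ hℓ aminus aplus a2minus a2plus ha ha2
  have hL0 : (0 : ℝ) < (ℓ : ℝ) + 1 := by positivity
  have hL1 : (1 : ℝ) ≤ (ℓ : ℝ) + 1 := by linarith [(Nat.cast_nonneg ℓ : (0 : ℝ) ≤ ℓ)]
  have hlog : Real.log ((ℓ : ℝ) + 1) ≤ (ℓ : ℝ) + 1 := (Real.log_le_sub_one_of_pos hL0).trans (by linarith)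
  have hlog0 : 0 ≤ Real.log ((ℓ : ℝ) + 1) := Real.log_nonneg hL1
  -- the output rate `σ = min(δ₀/16, δ₁/2)` (also the smallest (2.61)-rate) and the (2.59)-type threshold `N₁`
  obtain ⟨σ, hσ⟩ : ∃ σ : ℝ, σ = min (δ₀ / 16) (δ₁ / 2) := ⟨_, rfl⟩
  have hσ0 : 0 < σ := by rw [hσ]; exact lt_min (by positivity) (by positivity)
  have hσδ₀ : σ ≤ δ₀ / 16 := by rw [hσ]; exact min_le_left _ _
  have hσδ₁ : σ ≤ δ₁ / 2 := by rw [hσ]; exact min_le_right _ _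
  obtain ⟨N₁, hN₁⟩ : ∃ N₁ : ℕ, N₁ = ⌈128 * ((d : ℝ) + 1) * ((ℓ : ℝ) + 1) / σ⌉₊ + 1 := ⟨_, rfl⟩
  have hN₁pos : 0 < N₁ := by rw [hN₁]; omega
  have hN₁gt : 128 * ((d : ℝ) + 1) * ((ℓ : ℝ) + 1) < σ * (N₁ : ℝ) := by
    have h : 128 * ((d : ℝ) + 1) * ((ℓ : ℝ) + 1) / σ < (N₁ : ℝ) := by
      rw [hN₁]; push_cast
      exact lt_of_le_of_lt (Nat.le_ceil _) (by linarith)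
    rw [div_lt_iff₀ hσ0] at h
    linarith
  -- the (2.61)-constant and the constant `B`
  obtain ⟨cK, hcK⟩ : ∃ cK : ℝ, cK = K261 N₁ (d + 1) ((ℓ : ℝ) + 1) 1 (1 * σ) := ⟨_, rfl⟩
  have hcK0 : 0 ≤ cK := by rw [hcK]; exact K261_nonneg hL0.le zero_le_one
  obtain ⟨B, hB⟩ : ∃ B : ℝ, B = C₁ * C ^ 2 * ((ℓ : ℝ) + 1) ^ 6 * cK ^ 2 := ⟨_, rfl⟩
  have hB0 : 0 ≤ B := by rw [hB]; positivity
  refine ⟨σ, B + 1, M₀, max N₀ N₁, hσ0, by linarith, hM₀, lt_of_lt_of_le hN₀ (le_max_left _ _), ?_⟩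
  intro k Mh R hMh hM hR hRM P hP D a c haw hcw hac G hG x y'
  have hMh1 : 1 ≤ Mh := le_trans (by norm_num) hMh
  have hRM0 : N₀ + 1 ≤ R * ((ℓ + 1) * Mh) := le_trans (Nat.succ_le_succ (le_max_left _ _)) hRM
  have hRM1 : N₁ + 1 ≤ R * ((ℓ + 1) * Mh) := le_trans (Nat.succ_le_succ (le_max_right _ _)) hRM
  have hRMone : 1 ≤ R * ((ℓ + 1) * Mh) := le_trans (by omega) hRM1
  obtain ⟨hTG, hTD, -, hTL⟩ := h22 k Mh R hMh hM hR hRM0 P hP D a c haw hcw hac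
  have htri := (triangle_refl_nonneg D hMh1 hP).1
  have hdnn := (triangle_refl_nonneg D hMh1 hP).2.2
  have hlen0 : ∀ y : ↥(bset D), 0 ≤ (geom D).len y := fun y => (len_pos D y).le
  -- Lemma 2.1 on the box at the rate `σ`, and every larger rate
  have hθ : Real.exp (-(1 * σ)) * ((ℓ : ℝ) + 1) ^ ((2 * (d + 1 : ℕ) : ℝ) / N₁) < 1 := by
    refine theta_lt_one_of_log hL0 hN₁pos ?_
    push_cast
    nlinarith [mul_le_mul_of_nonneg_left hlog (by positivity : (0 : ℝ) ≤ 2 * ((d : ℝ) + 1))]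
  obtain ⟨-, h261, -, -⟩ := lemma21_box D hMh1 hP hN₁pos hRM1 hσ0.le (α := 1) zero_le_one le_rfl hθ
  rw [← hcK] at h261
  have hrow : ∀ τ : ℝ, σ ≤ τ → ∀ y : (geom D).Site,
      ∑ y'' : (geom D).Site, Real.exp (-(τ * (geom D).dist y y'')) ≤ cK := by
    intro τ hτ y
    have h := ineq261With_of_le (g := geom D) h261 (δ' := τ) (α' := 1) (by linarith) hdnn y
    simpa only [one_mul] using h
  -- the thresholds `L⁴ ≤ e^{⅛δ₀(RM−1)}` and `L² ≤ e^{⅛δ₀(RM−1)}`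
  have hthr4 : ((ℓ : ℝ) + 1) ^ 4 ≤ Real.exp (δ₀ / 8 * ((geomB D).R * (geomB D).M)) := by
    rw [geomB_RM D hMh1]
    have hge : (N₁ : ℝ) ≤ (R : ℝ) * (((ℓ : ℝ) + 1) * Mh) - 1 := by
      have : ((N₁ + 1 : ℕ) : ℝ) ≤ ((R * ((ℓ + 1) * Mh) : ℕ) : ℝ) := by exact_mod_cast hRM1
      push_cast at this; linarith
    have h4 : 4 * Real.log ((ℓ : ℝ) + 1) ≤ δ₀ / 8 * ((R : ℝ) * (((ℓ : ℝ) + 1) * Mh) - 1) := by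
      have h1 : σ * (N₁ : ℝ) ≤ δ₀ / 8 * ((R : ℝ) * (((ℓ : ℝ) + 1) * Mh) - 1) :=
        calc σ * (N₁ : ℝ) ≤ δ₀ / 8 * (N₁ : ℝ) := mul_le_mul_of_nonneg_right (by linarith) (Nat.cast_nonneg _)
          _ ≤ δ₀ / 8 * ((R : ℝ) * (((ℓ : ℝ) + 1) * Mh) - 1) := mul_le_mul_of_nonneg_left hge (by positivity)
      have hd0 : (0 : ℝ) ≤ (d : ℝ) := Nat.cast_nonneg d
      nlinarith
    calc ((ℓ : ℝ) + 1) ^ 4 = Real.exp (4 * Real.log ((ℓ : ℝ) + 1)) := by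
          rw [← Real.exp_log (pow_pos hL0 4), Real.log_pow]; norm_num
      _ ≤ _ := Real.exp_le_exp.2 h4
  have hthr2 : ((ℓ : ℝ) + 1) ^ 2 ≤ Real.exp (δ₀ / 8 * ((geomB D).R * (geomB D).M)) :=
    (pow_le_pow_right₀ hL1 (by norm_num : 2 ≤ 4)).trans hthr4
  -- the Prop.-2.2 majorants with the lengths `(geom D).len`
  have hTG' : HasMajorant (g := geom D) (blkOf D) (Matrix.toLin' (gml (N0 ℓ Mh k P) ℓ k D.lev a))
      (fun y y' => C * (geom D).len y ^ 2 * Real.exp (-(δ₀ / 2 * (geom D).dist y y'))) := by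
    refine hasMajorant_mono (g := geom D) (blkOf D) hTG fun y y' => le_of_eq ?_
    rw [len_eq, ← pow_mul, Nat.mul_comm]
  have hTD' : ∀ μ : Fin (d + 1), HasMajorant (g := geom D) (blkOf D)
      (Matrix.toLin' (dMat (N0 ℓ Mh k P) μ * gml (N0 ℓ Mh k P) ℓ k D.lev a))
      (fun y y' => C * (geom D).len y * Real.exp (-(δ₀ / 2 * (geom D).dist y y'))) := by
    intro μ
    refine hasMajorant_mono (g := geom D) (blkOf D) (hTD μ) fun y y' => le_of_eq ?_
    rw [len_eq]
  have hTL' : HasMajorant (g := geom D) (blkOf D)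
      (Matrix.toLin' (opBoxR 1 0 0 1 (N0 ℓ Mh k P) * gml (N0 ℓ Mh k P) ℓ k D.lev a))
      (fun y y' => C * (1 : ℝ) * Real.exp (-(δ₀ / 2 * (geom D).dist y y'))) := by
    refine hasMajorant_mono (g := geom D) (blkOf D) hTL fun y y' => le_of_eq ?_
    rw [mul_one]
  -- the composite majorants of `G′G′`, `∂_μG′·G′`, `(−Δ)G′·G′` (§3)
  have hσ8 : σ ≤ δ₀ / 8 := by linarith
  have hK0 := hasMajorant_comp (D := D) hMh1 hP hRMone hC.le hδ₀ (p := fun y => (geom D).len y ^ 2)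
    (fun y => pow_nonneg (hlen0 y) 2) hTG' hTG' (hrow (δ₀ / 8) hσ8) hthr2
  have hK1 : ∀ μ : Fin (d + 1), _ := fun μ => hasMajorant_comp (D := D) hMh1 hP hRMone hC.le hδ₀
    (p := fun y => (geom D).len y) hlen0 (hTD' μ) hTG' (hrow (δ₀ / 8) hσ8) hthr2
  have hp1 : ∀ _y : ↥(bset D), (0 : ℝ) ≤ 1 := fun _ => zero_le_one
  have hK2 := hasMajorant_comp (D := D) hMh1 hP hRMone hC.le hδ₀ (p := fun _ => (1 : ℝ))
    hp1 hTL' hTG' (hrow (δ₀ / 8) hσ8) hthr2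
  -- the `G`-step: `|G(y, y′)·W(y′)| ≤ C₁(Lʲ)⁻⁴e^{−½δ₁d}`; `u = Q′*(Gδ_{y′})` is the column `z ↦ mat G y(z) y′`
  have hmat : ∀ y : ↥(bset D), |mat G y y'| ≤
      C₁ * (((geom D).len y ^ 4)⁻¹ * Real.exp (-(δ₁ / 2 * (geom D).dist y y'))) := by
    intro y
    have h := hG y y'
    have hWpos := W_pos D y'
    have hW : W D y' = (geom D).len y' ^ (d + 1) := rfl
    rw [abs_div, abs_of_pos hWpos, div_le_iff₀ hWpos, rpow_neg_four_eq (len_pos D y),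
      rpow_neg_natCast_eq (len_pos D y'), hW] at h
    calc |mat G y y'| ≤ _ := h
      _ = C₁ * ((geom D).len y ^ 4)⁻¹ * Real.exp (-(δ₁ / 2 * (geom D).dist y y')) *
            (((geom D).len y' ^ (d + 1))⁻¹ * (geom D).len y' ^ (d + 1)) := by ring
      _ = C₁ * (((geom D).len y ^ 4)⁻¹ * Real.exp (-(δ₁ / 2 * (geom D).dist y y'))) := by
            rw [inv_mul_cancel₀ (pow_pos (len_pos D y') _).ne', mul_one, mul_assoc]
  have hu : ∀ z : ↥(boxDom (N0 ℓ Mh k P)), |QsB D (G (Pi.single y' 1)) z| ≤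
      C₁ * (((geom D).len (blkOf D z) ^ 4)⁻¹ * Real.exp (-(δ₁ / 2 * (geom D).dist (blkOf D z) y'))) :=
    fun z => by rw [QsB_single_apply]; exact hmat _
  -- scale absorption for `(L^{j″})⁻⁴` and the 𝔅-convolution with the decaying column, for each left factor
  have hf4 : ∀ y y'' : (geom D).Site, ((geom D).len y'' ^ 4)⁻¹ ≤
      ((ℓ : ℝ) + 1) ^ 4 * Real.exp (δ₀ / 8 * (geom D).dist y y'') * ((geom D).len y ^ 4)⁻¹ :=
    fun y y'' => inv_pow_len_le hMh1 hP hRMone 4 (by positivity) hthr4 y y''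
  have key : ∀ {T : Module.End ℝ (↥(boxDom (N0 ℓ Mh k P)) → ℝ)} {p : ↥(bset D) → ℝ}, (∀ y, 0 ≤ p y) →
      HasMajorant (g := geom D) (blkOf D) T
        (fun y y' => C ^ 2 * (((ℓ : ℝ) + 1) ^ 2 * cK) * (p y * (geom D).len y ^ 2) *
          Real.exp (-(δ₀ / 4 * (geom D).dist y y'))) →
      |T (QsB D (G (Pi.single y' 1))) x| ≤ B * (p (blkOf D x) * (geom D).len (blkOf D x) ^ 2 *
        ((geom D).len (blkOf D x) ^ 4)⁻¹) * Real.exp (-(σ * (geom D).dist (blkOf D x) y')) := by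
    intro T p hp hT
    have h1 := abs_apply_le_of_levelBound (g := geom D) (blkOf D) hT
      (p := fun b => ((geom D).len b ^ 4)⁻¹ * Real.exp (-(δ₁ / 2 * (geom D).dist b y'))) hC₁.le
      (fun b => mul_nonneg (inv_nonneg.2 (pow_nonneg (hlen0 b) 4)) (Real.exp_nonneg _)) hu x
    have h2 := levelConv_le (g := geom D) htri hdnn (σ₁ := δ₀ / 4) (σ₂ := δ₁ / 2) (β := δ₀ / 8) (ρ := σ)
      (τ := δ₀ / 16) (A := ((ℓ : ℝ) + 1) ^ 4) (c := cK) hσ0.le hσδ₁ (by linarith) (by positivity)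
      (f := fun b => ((geom D).len b ^ 4)⁻¹) (fun b => inv_nonneg.2 (pow_nonneg (hlen0 b) 4)) hf4
      (hrow (δ₀ / 16) hσδ₀) (blkOf D x) y'
    refine h1.trans ?_
    have hq : 0 ≤ C ^ 2 * (((ℓ : ℝ) + 1) ^ 2 * cK) * (p (blkOf D x) * (geom D).len (blkOf D x) ^ 2) :=
      mul_nonneg (by positivity) (mul_nonneg (hp _) (pow_nonneg (hlen0 _) 2))
    have hsum : ∑ b' : (geom D).Site, C ^ 2 * (((ℓ : ℝ) + 1) ^ 2 * cK) *
          (p (blkOf D x) * (geom D).len (blkOf D x) ^ 2) * Real.exp (-(δ₀ / 4 * (geom D).dist (blkOf D x) b')) *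
          (((geom D).len b' ^ 4)⁻¹ * Real.exp (-(δ₁ / 2 * (geom D).dist b' y')))
        = C ^ 2 * (((ℓ : ℝ) + 1) ^ 2 * cK) * (p (blkOf D x) * (geom D).len (blkOf D x) ^ 2) *
          ∑ b' : (geom D).Site, Real.exp (-(δ₀ / 4 * (geom D).dist (blkOf D x) b')) * ((geom D).len b' ^ 4)⁻¹ *
            Real.exp (-(δ₁ / 2 * (geom D).dist b' y')) := by
      rw [Finset.mul_sum]
      exact Finset.sum_congr rfl fun b' _ => by ring
    rw [hsum]
    calc C₁ * (C ^ 2 * (((ℓ : ℝ) + 1) ^ 2 * cK) * (p (blkOf D x) * (geom D).len (blkOf D x) ^ 2) *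
          ∑ b' : (geom D).Site, Real.exp (-(δ₀ / 4 * (geom D).dist (blkOf D x) b')) * ((geom D).len b' ^ 4)⁻¹ *
            Real.exp (-(δ₁ / 2 * (geom D).dist b' y')))
        ≤ C₁ * (C ^ 2 * (((ℓ : ℝ) + 1) ^ 2 * cK) * (p (blkOf D x) * (geom D).len (blkOf D x) ^ 2) *
          (((ℓ : ℝ) + 1) ^ 4 * cK * ((geom D).len (blkOf D x) ^ 4)⁻¹ *
            Real.exp (-(σ * (geom D).dist (blkOf D x) y')))) :=
          mul_le_mul_of_nonneg_left (mul_le_mul_of_nonneg_left h2 hq) hC₁.le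
      _ = B * (p (blkOf D x) * (geom D).len (blkOf D x) ^ 2 * ((geom D).len (blkOf D x) ^ 4)⁻¹) *
          Real.exp (-(σ * (geom D).dist (blkOf D x) y')) := by
          rw [hB]; ring
  -- the three bounds
  have hlx : (geom D).len (blkOf D x) = ((ℓ : ℝ) + 1) ^ D.lev x.1 := len_blkOf D x
  have hlam : 0 < ((ℓ : ℝ) + 1) ^ D.lev x.1 := pow_pos hL0 _
  have hE : 0 ≤ Real.exp (-(σ * (geom D).dist (blkOf D x) y')) := Real.exp_nonneg _
  refine ⟨?_, fun μ => ?_, ?_⟩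
  · have h := key (p := fun y => (geom D).len y ^ 2) (fun y => pow_nonneg (hlen0 y) 2) hK0
    have e : hPrimeML D a G (Pi.single y' 1) x =
        (Matrix.toLin' (gml (N0 ℓ Mh k P) ℓ k D.lev a) * Matrix.toLin' (gml (N0 ℓ Mh k P) ℓ k D.lev a))
          (QsB D (G (Pi.single y' 1))) x := rfl
    rw [e]
    refine h.trans ?_
    rw [hlx]
    have e2 : (((ℓ : ℝ) + 1) ^ D.lev x.1) ^ 2 * (((ℓ : ℝ) + 1) ^ D.lev x.1) ^ 2 *
        ((((ℓ : ℝ) + 1) ^ D.lev x.1) ^ 4)⁻¹ = 1 := by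
      field_simp
    rw [e2, mul_one]
    exact mul_le_mul_of_nonneg_right (by linarith) hE
  · have h := key (p := fun y => (geom D).len y) hlen0 (hK1 μ)
    have e : (dMat (N0 ℓ Mh k P) μ *ᵥ hPrimeML D a G (Pi.single y' 1)) x =
        (Matrix.toLin' (dMat (N0 ℓ Mh k P) μ * gml (N0 ℓ Mh k P) ℓ k D.lev a) *
          Matrix.toLin' (gml (N0 ℓ Mh k P) ℓ k D.lev a)) (QsB D (G (Pi.single y' 1))) x := by
      simp only [hPrimeML, LinearMap.comp_apply, Module.End.mul_apply, Matrix.toLin'_apply, Matrix.mulVec_mulVec,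
        Matrix.mul_assoc]
    rw [e]
    refine h.trans ?_
    rw [hlx]
    have e2 : ((ℓ : ℝ) + 1) ^ D.lev x.1 * (((ℓ : ℝ) + 1) ^ D.lev x.1) ^ 2 *
        ((((ℓ : ℝ) + 1) ^ D.lev x.1) ^ 4)⁻¹ = (((ℓ : ℝ) + 1) ^ D.lev x.1)⁻¹ := by
      field_simp
    rw [e2]
    refine mul_le_mul_of_nonneg_right ?_ hE
    have h0 : 0 ≤ (((ℓ : ℝ) + 1) ^ D.lev x.1)⁻¹ := inv_nonneg.2 hlam.le
    exact mul_le_mul_of_nonneg_right (by linarith) h0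
  · have h := key (p := fun _ => (1 : ℝ)) hp1 hK2
    have e : (opBoxR 1 0 0 1 (N0 ℓ Mh k P) *ᵥ hPrimeML D a G (Pi.single y' 1)) x =
        (Matrix.toLin' (opBoxR 1 0 0 1 (N0 ℓ Mh k P) * gml (N0 ℓ Mh k P) ℓ k D.lev a) *
          Matrix.toLin' (gml (N0 ℓ Mh k P) ℓ k D.lev a)) (QsB D (G (Pi.single y' 1))) x := by
      simp only [hPrimeML, LinearMap.comp_apply, Module.End.mul_apply, Matrix.toLin'_apply, Matrix.mulVec_mulVec,
        Matrix.mul_assoc]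
    rw [e]
    refine h.trans ?_
    rw [hlx]
    have e2 : (1 : ℝ) * (((ℓ : ℝ) + 1) ^ D.lev x.1) ^ 2 * ((((ℓ : ℝ) + 1) ^ D.lev x.1) ^ 4)⁻¹ =
        ((((ℓ : ℝ) + 1) ^ D.lev x.1) ^ 2)⁻¹ := by
      field_simp
    rw [e2]
    refine mul_le_mul_of_nonneg_right ?_ hE
    have h0 : 0 ≤ ((((ℓ : ℝ) + 1) ^ D.lev x.1) ^ 2)⁻¹ := inv_nonneg.2 (pow_pos hlam 2).le
    exact mul_le_mul_of_nonneg_right (by linarith) h0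

/-- **the (2.69)-kernel `H′(x, y′)` itself**: `|H′(x, y′)| ≦ B(L^{j′})^{−(d+1)}e^{−ρd(y(x),y′)}` (divide by the weight
`W(y′) = (L^{j′})^{d+1}`), the shape in which [B6]/[4] print kernels on `𝔅`. [cite: Balaban1985RegularSpaces, p.92; Balaban1984PropagatorsII, (2.69) p.235, Prop. 2.3 (2.87) p.238] -/
theorem hKer_decay_of_inverse (d ℓ : ℕ) (hℓ : 1 ≤ ℓ) (aminus aplus a2minus a2plus : ℝ) (ha : 0 < aminus)
    (ha2 : 0 < a2minus) {C₁ δ₁ : ℝ} (hC₁ : 0 < C₁) (hδ₁ : 0 < δ₁) :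
    ∃ ρ B M₀ : ℝ, ∃ N₀ : ℕ, 0 < ρ ∧ 0 < B ∧ 0 < M₀ ∧ 0 < N₀ ∧
      ∀ (k Mh R : ℕ), 3 ≤ Mh → M₀ ≤ ((ℓ : ℝ) + 1) * Mh → 2 * (ℓ + 1) ≤ R → N₀ + 1 ≤ R * ((ℓ + 1) * Mh) →
      ∀ (P : Fin (d + 1) → ℕ) (_hP : ∀ μ, 1 ≤ P μ) (D : Domains d ℓ Mh k P R) (a c : ℕ → ℝ),
        (∀ i, aminus ≤ a i ∧ a i ≤ aplus) → (∀ i, a2minus ≤ c i ∧ c i ≤ a2plus) →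
        (∀ i, a (i + 1) = aNext ℓ (a i) (c i)) →
        ∀ G : Module.End ℝ (↥(bset D) → ℝ),
          (∀ y y' : ↥(bset D), |mat G y y' / W D y'| ≤
            C₁ * (geom D).len y ^ (-(4 : ℝ)) * (geom D).len y' ^ (-((d + 1 : ℕ) : ℝ)) *
              Real.exp (-(δ₁ / 2 * (geom D).dist y y'))) →
          ∀ (x : ↥(boxDom (N0 ℓ Mh k P))) (y' : ↥(bset D)),
            |hKer D a G x y'| ≤ B * (W D y')⁻¹ * Real.exp (-(ρ * (geom D).dist (blkOf D x) y')) := by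
  obtain ⟨ρ, B, M₀, N₀, hρ, hB, hM₀, hN₀, h⟩ :=
    hPrime_single_decay_of_inverse d ℓ hℓ aminus aplus a2minus a2plus ha ha2 hC₁ hδ₁
  refine ⟨ρ, B, M₀, N₀, hρ, hB, hM₀, hN₀, ?_⟩
  intro k Mh R hMh hM hR hRM P hP D a c haw hcw hac G hG x y'
  have h1 := (h k Mh R hMh hM hR hRM P hP D a c haw hcw hac G hG x y').1
  have hW := W_pos D y'
  unfold hKer
  rw [abs_div, abs_of_pos hW, div_le_iff₀ hW, mul_assoc (B * (W D y')⁻¹), mul_comm (B * (W D y')⁻¹), ← mul_assoc,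
    mul_assoc _ B, mul_comm _ (B * (W D y')⁻¹)]
  calc |hPrimeML D a G (Pi.single y' 1) x| ≤ B * Real.exp (-(ρ * (geom D).dist (blkOf D x) y')) := h1
    _ = B * (W D y')⁻¹ * (Real.exp (-(ρ * (geom D).dist (blkOf D x) y')) * W D y') := by
        field_simp

end Kernel

/-! ## §5  (1.92) at U₀ = 1 on the `k`-level box family -/

section Main

/-- **(1.92) AT U₀ = 1 ON THE `k`-LEVEL NEUMANN-BOX FAMILY, THE INVERSE `(Q′G′²Q′*)⁻¹` ENTERING BY ITS (2.87)-BOUND** —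
«|(H′X)(x)|, |(∇H′X)(x)| ≦ B′₀[1, (Lʲη)⁻¹]|X| for x ∈ Ω_j» plus the Δ-entry of p. 93: for every `C₁, δ₁ > 0` there are
`B′₀, M₀ > 0` and `N₀ ≥ 1` (functions of `d`, `ℓ`, the weight windows, `C₁`, `δ₁`) such that for every number of levels `k`,
every `M_h ≥ 3` with `L·M_h ≥ M₀`, every `R ≥ 2L` with `R·L·M_h ≥ N₀ + 1` («M, RM sufficiently large»), every box `P`, every
nested family `D` of block-union domains with (2.1)–(2.2), every weight sequence in the windows with `a_{i+1} = aNext ℓ a_i c_i`,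
EVERY operator `G` on `𝔅` with `|G(y, y′)| ≦ C₁(Lʲ)⁻⁴(L^{j′})^{−(d+1)}e^{−½δ₁d(y,y′)}` (the printed bound (2.87) of [B6]
Prop. 2.3 for `(Q′G′²Q′*)⁻¹`, in the (2.69) convention `G(y, y′) = mat G y y′ / W(y′)`), every `X : 𝔅 → ℝ` with `|X(y′)| ≦ S`
and every fine point `x` of the box, at its level `j = D.lev x` (`x ∈ B^j(Λ_j) ⊂ Ω_j`):
`|(H′X)(x)| ≦ B′₀S`, `|(∂_μH′X)(x)| ≦ B′₀(Lʲ)⁻¹S` for every axis `μ`, and `|((−Δ^N)H′X)(x)| ≦ B′₀(Lʲ)⁻²S` — for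
`H′ = G′²Q′*G` (`hPrimeML`) with the GENUINE `G′ = Δ′_a⁻¹`, `Q′*`.  From the kernel decay `hPrime_single_decay_of_inverse`
through p. 92's display `(H′X)(x) = Σ_{y′}(L^{j′}η)^{d+1}H′(x, y′)X(y′)` and the row sum (2.61) (`lemma21_box`); print's
«B′₀ … depending on d and L only» at the series' fixed `a`. [cite: Balaban1985RegularSpaces, (1.91)–(1.92) pp.91–92, p.93 l.1–4; Balaban1984PropagatorsII, Prop. 2.2 (2.67) p.234, Prop. 2.3 (2.87) p.238, Lemma 2.1 (2.60)–(2.61) p.234, (2.68) p.235] -/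
theorem ineq192_multiLevelBox_of_inverse (d ℓ : ℕ) (hℓ : 1 ≤ ℓ) (aminus aplus a2minus a2plus : ℝ) (ha : 0 < aminus)
    (ha2 : 0 < a2minus) {C₁ δ₁ : ℝ} (hC₁ : 0 < C₁) (hδ₁ : 0 < δ₁) :
    ∃ B₀' M₀ : ℝ, ∃ N₀ : ℕ, 0 < B₀' ∧ 0 < M₀ ∧ 0 < N₀ ∧
      ∀ (k Mh R : ℕ), 3 ≤ Mh → M₀ ≤ ((ℓ : ℝ) + 1) * Mh → 2 * (ℓ + 1) ≤ R → N₀ + 1 ≤ R * ((ℓ + 1) * Mh) →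
      ∀ (P : Fin (d + 1) → ℕ) (_hP : ∀ μ, 1 ≤ P μ) (D : Domains d ℓ Mh k P R) (a c : ℕ → ℝ),
        (∀ i, aminus ≤ a i ∧ a i ≤ aplus) → (∀ i, a2minus ≤ c i ∧ c i ≤ a2plus) →
        (∀ i, a (i + 1) = aNext ℓ (a i) (c i)) →
        ∀ G : Module.End ℝ (↥(bset D) → ℝ),
          (∀ y y' : ↥(bset D), |mat G y y' / W D y'| ≤
            C₁ * (geom D).len y ^ (-(4 : ℝ)) * (geom D).len y' ^ (-((d + 1 : ℕ) : ℝ)) *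
              Real.exp (-(δ₁ / 2 * (geom D).dist y y'))) →
          ∀ (X : ↥(bset D) → ℝ) (S : ℝ), 0 ≤ S → (∀ y', |X y'| ≤ S) →
            ∀ x : ↥(boxDom (N0 ℓ Mh k P)),
              |hPrimeML D a G X x| ≤ B₀' * S ∧
              (∀ μ : Fin (d + 1), |(dMat (N0 ℓ Mh k P) μ *ᵥ hPrimeML D a G X) x| ≤
                B₀' * (((ℓ : ℝ) + 1) ^ D.lev x.1)⁻¹ * S) ∧
              |(opBoxR 1 0 0 1 (N0 ℓ Mh k P) *ᵥ hPrimeML D a G X) x| ≤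
                B₀' * ((((ℓ : ℝ) + 1) ^ D.lev x.1) ^ 2)⁻¹ * S := by
  obtain ⟨ρ, B, M₀, N₀, hρ, hB, hM₀, hN₀, hker⟩ :=
    hPrime_single_decay_of_inverse d ℓ hℓ aminus aplus a2minus a2plus ha ha2 hC₁ hδ₁
  have hL0 : (0 : ℝ) < (ℓ : ℝ) + 1 := by positivity
  have hL1 : (1 : ℝ) ≤ (ℓ : ℝ) + 1 := by linarith [(Nat.cast_nonneg ℓ : (0 : ℝ) ≤ ℓ)]
  have hlog : Real.log ((ℓ : ℝ) + 1) ≤ (ℓ : ℝ) + 1 := (Real.log_le_sub_one_of_pos hL0).trans (by linarith)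
  -- the (2.59)-type threshold for Lemma 2.1 at the rate `ρ`, and its constant
  obtain ⟨N₂, hN₂⟩ : ∃ N₂ : ℕ, N₂ = ⌈4 * ((d : ℝ) + 1) * ((ℓ : ℝ) + 1) / ρ⌉₊ + 1 := ⟨_, rfl⟩
  have hN₂pos : 0 < N₂ := by rw [hN₂]; omega
  have hN₂gt : 4 * ((d : ℝ) + 1) * ((ℓ : ℝ) + 1) < ρ * (N₂ : ℝ) := by
    have h : 4 * ((d : ℝ) + 1) * ((ℓ : ℝ) + 1) / ρ < (N₂ : ℝ) := by
      rw [hN₂]; push_cast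
      exact lt_of_le_of_lt (Nat.le_ceil _) (by linarith)
    rw [div_lt_iff₀ hρ] at h
    linarith
  obtain ⟨cK, hcK⟩ : ∃ cK : ℝ, cK = K261 N₂ (d + 1) ((ℓ : ℝ) + 1) 1 (1 * ρ) := ⟨_, rfl⟩
  have hcK0 : 0 ≤ cK := by rw [hcK]; exact K261_nonneg hL0.le zero_le_one
  refine ⟨B * cK + 1, M₀, max N₀ N₂, by positivity, hM₀, lt_of_lt_of_le hN₀ (le_max_left _ _), ?_⟩
  intro k Mh R hMh hM hR hRM P hP D a c haw hcw hac G hG X S hS hX x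
  have hMh1 : 1 ≤ Mh := le_trans (by norm_num) hMh
  have hRM0 : N₀ + 1 ≤ R * ((ℓ + 1) * Mh) := le_trans (Nat.succ_le_succ (le_max_left _ _)) hRM
  have hRM2 : N₂ + 1 ≤ R * ((ℓ + 1) * Mh) := le_trans (Nat.succ_le_succ (le_max_right _ _)) hRM
  have hK := hker k Mh R hMh hM hR hRM0 P hP D a c haw hcw hac G hG x
  -- Lemma 2.1 on the box at the rate `ρ`
  have hθ : Real.exp (-(1 * ρ)) * ((ℓ : ℝ) + 1) ^ ((2 * (d + 1 : ℕ) : ℝ) / N₂) < 1 := by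
    refine theta_lt_one_of_log hL0 hN₂pos ?_
    push_cast
    nlinarith [mul_le_mul_of_nonneg_left hlog (by positivity : (0 : ℝ) ≤ 2 * ((d : ℝ) + 1))]
  obtain ⟨-, h261, -, -⟩ := lemma21_box D hMh1 hP hN₂pos hRM2 hρ.le (α := 1) zero_le_one le_rfl hθ
  rw [← hcK] at h261
  have hrow' : ∑ y' : (geom D).Site, Real.exp (-(ρ * (geom D).dist (blkOf D x) y')) ≤ cK := by
    have h := h261 (blkOf D x)
    simpa only [one_mul] using h
  have hrow : ∑ y' : ↥(bset D), Real.exp (-(ρ * (geom D).dist (blkOf D x) y')) ≤ cK := hrow'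
  have hlam0 : 0 < ((ℓ : ℝ) + 1) ^ D.lev x.1 := pow_pos hL0 _
  have hBS : ∀ {q : ℝ}, 0 ≤ q → B * cK * q * S ≤ (B * cK + 1) * q * S := by
    intro q hq
    have e3 : (B * cK + 1) * q * S = B * cK * q * S + q * S := by ring
    rw [e3]
    linarith [mul_nonneg hq hS]
  refine ⟨?_, fun μ => ?_, ?_⟩
  · rw [apply_eq_sum_single]
    have h := abs_sum_mul_le_of_decay (dist := fun y' => (geom D).dist (blkOf D x) y') hB.le hS
      (fun y' => (hK y').1) hX hrow
    refine h.trans ?_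
    have h1 := hBS zero_le_one
    simp only [mul_one] at h1
    exact h1
  · rw [mulVec_hPrimeML_eq_sum]
    have h := abs_sum_mul_le_of_decay (dist := fun y' => (geom D).dist (blkOf D x) y')
      (B := B * (((ℓ : ℝ) + 1) ^ D.lev x.1)⁻¹) (mul_nonneg hB.le (inv_nonneg.2 hlam0.le)) hS
      (fun y' => (hK y').2.1 μ) hX hrow
    refine h.trans ?_
    calc B * (((ℓ : ℝ) + 1) ^ D.lev x.1)⁻¹ * cK * S = B * cK * (((ℓ : ℝ) + 1) ^ D.lev x.1)⁻¹ * S := by ring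
      _ ≤ (B * cK + 1) * (((ℓ : ℝ) + 1) ^ D.lev x.1)⁻¹ * S := hBS (inv_nonneg.2 hlam0.le)
  · rw [mulVec_hPrimeML_eq_sum]
    have h := abs_sum_mul_le_of_decay (dist := fun y' => (geom D).dist (blkOf D x) y')
      (B := B * ((((ℓ : ℝ) + 1) ^ D.lev x.1) ^ 2)⁻¹) (mul_nonneg hB.le (inv_nonneg.2 (pow_pos hlam0 2).le)) hS
      (fun y' => (hK y').2.2) hX hrow
    refine h.trans ?_
    calc B * ((((ℓ : ℝ) + 1) ^ D.lev x.1) ^ 2)⁻¹ * cK * S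
        = B * cK * ((((ℓ : ℝ) + 1) ^ D.lev x.1) ^ 2)⁻¹ * S := by ring
      _ ≤ (B * cK + 1) * ((((ℓ : ℝ) + 1) ^ D.lev x.1) ^ 2)⁻¹ * S := hBS (inv_nonneg.2 (pow_pos hlam0 2).le)

/-- **(1.92) at U₀ = 1 on the `k`-level box family, in the sup norm** `|X| := max_{y′∈𝔅}|X(y′)|` («≦ B′₀[1, (Lʲη)⁻¹]|X|»).
[cite: Balaban1985RegularSpaces, (1.92) pp.91–92, p.93 l.1–4] -/
theorem ineq192_multiLevelBox_supNorm (d ℓ : ℕ) (hℓ : 1 ≤ ℓ) (aminus aplus a2minus a2plus : ℝ) (ha : 0 < aminus)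
    (ha2 : 0 < a2minus) {C₁ δ₁ : ℝ} (hC₁ : 0 < C₁) (hδ₁ : 0 < δ₁) :
    ∃ B₀' M₀ : ℝ, ∃ N₀ : ℕ, 0 < B₀' ∧ 0 < M₀ ∧ 0 < N₀ ∧
      ∀ (k Mh R : ℕ), 3 ≤ Mh → M₀ ≤ ((ℓ : ℝ) + 1) * Mh → 2 * (ℓ + 1) ≤ R → N₀ + 1 ≤ R * ((ℓ + 1) * Mh) →
      ∀ (P : Fin (d + 1) → ℕ) (_hP : ∀ μ, 1 ≤ P μ) (D : Domains d ℓ Mh k P R) (a c : ℕ → ℝ),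
        (∀ i, aminus ≤ a i ∧ a i ≤ aplus) → (∀ i, a2minus ≤ c i ∧ c i ≤ a2plus) →
        (∀ i, a (i + 1) = aNext ℓ (a i) (c i)) →
        ∀ G : Module.End ℝ (↥(bset D) → ℝ),
          (∀ y y' : ↥(bset D), |mat G y y' / W D y'| ≤
            C₁ * (geom D).len y ^ (-(4 : ℝ)) * (geom D).len y' ^ (-((d + 1 : ℕ) : ℝ)) *
              Real.exp (-(δ₁ / 2 * (geom D).dist y y'))) →
          ∀ (X : ↥(bset D) → ℝ) (hne : (Finset.univ : Finset ↥(bset D)).Nonempty) (x : ↥(boxDom (N0 ℓ Mh k P))),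
              |hPrimeML D a G X x| ≤ B₀' * Finset.univ.sup' hne (fun y' => |X y'|) ∧
              (∀ μ : Fin (d + 1), |(dMat (N0 ℓ Mh k P) μ *ᵥ hPrimeML D a G X) x| ≤
                B₀' * (((ℓ : ℝ) + 1) ^ D.lev x.1)⁻¹ * Finset.univ.sup' hne (fun y' => |X y'|)) ∧
              |(opBoxR 1 0 0 1 (N0 ℓ Mh k P) *ᵥ hPrimeML D a G X) x| ≤
                B₀' * ((((ℓ : ℝ) + 1) ^ D.lev x.1) ^ 2)⁻¹ * Finset.univ.sup' hne (fun y' => |X y'|) := by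
  obtain ⟨B₀', M₀, N₀, hB, hM₀, hN₀, h⟩ :=
    ineq192_multiLevelBox_of_inverse d ℓ hℓ aminus aplus a2minus a2plus ha ha2 hC₁ hδ₁
  refine ⟨B₀', M₀, N₀, hB, hM₀, hN₀, ?_⟩
  intro k Mh R hMh hM hR hRM P hP D a c haw hcw hac G hG X hne x
  obtain ⟨y₀, hy₀⟩ := hne
  refine h k Mh R hMh hM hR hRM P hP D a c haw hcw hac G hG X _ ?_
    (fun y' => Finset.le_sup' (fun y' => |X y'|) (Finset.mem_univ y')) x
  exact le_trans (abs_nonneg _) (Finset.le_sup' (fun y' => |X y'|) (Finset.mem_univ y₀))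

end Main

/-! ## §6  The projection `R = 1 − G′Q′*(Q′G′²Q′*)⁻¹Q′G′` of [4] (3.25) at U₀ = 1 on the `k`-level box family: «|Rf| ≦ B′₀|f|» -/

section RProj

variable {ℓ Mh k R : ℕ} {P : Fin (d + 1) → ℕ} (D : Domains d ℓ Mh k P R) (a : ℕ → ℝ)

/-- **The gauge-fixing projection at U₀ = 1 on the `k`-level box family**: `R = 1 − G′·Q′*·G·Q′·G′` — the formula (3.25) of
[4] «Rf = (I − G′Q′\*(Q′G′²Q′\*)⁻¹Q′G′)f» (= [B5] (1.44), the flat predecessor) for the GENUINE multi-level `G′ = Δ′_a⁻¹`, `Q′`,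
`Q′*`, with `G` standing for `(Q′G′²Q′*)⁻¹`; B8's `R(U₀)` of (1.27) at the flat background. [cite: Balaban1985RegularSpaces, (1.27) p.80, p.92; Balaban1985BackgroundPropagators, (3.25) p.394; Balaban1984PropagatorsI, (1.44) p.25] -/
def rProjML (G : Module.End ℝ (↥(bset D) → ℝ)) : Module.End ℝ (↥(boxDom (N0 ℓ Mh k P)) → ℝ) :=
  1 - Matrix.toLin' (gml (N0 ℓ Mh k P) ℓ k D.lev a) * (QsB D ∘ₗ G ∘ₗ QB D) *
    Matrix.toLin' (gml (N0 ℓ Mh k P) ℓ k D.lev a)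

variable {D a}

/-- `Rf = f − G′(Q′*(G(Q′(G′f))))`. [cite: Balaban1985BackgroundPropagators, (3.25) p.394] -/
theorem rProjML_apply (G : Module.End ℝ (↥(bset D) → ℝ)) (f : ↥(boxDom (N0 ℓ Mh k P)) → ℝ) :
    rProjML D a G f = f - gml (N0 ℓ Mh k P) ℓ k D.lev a *ᵥ QsB D (G (QB D (gml (N0 ℓ Mh k P) ℓ k D.lev a *ᵥ f))) := by
  simp only [rProjML, LinearMap.sub_apply, Module.End.one_apply, Module.End.mul_apply, LinearMap.comp_apply,
    Matrix.toLin'_apply]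

/-- the letters `Q′·G′·G′·Q′*` ARE the operator `Q′G′²Q′*` with (2.69)-kernel `Xk` (`B6Ineq268MultiLevelBoxL0.kerOp_Xk`).
[cite: Balaban1984PropagatorsII, (2.68)–(2.69) p.235] -/
theorem QB_gml_gml_QsB (w : ↥(B6Geom246MultiLevelBoxL0.bset D) → ℝ) :
    QB D (gml (N0 ℓ Mh k P) ℓ k D.lev a *ᵥ (gml (N0 ℓ Mh k P) ℓ k D.lev a *ᵥ QsB D w)) = kerOp (W D) (Xk D a) w := by
  rw [kerOp_Xk]
  simp only [LinearMap.comp_apply, Matrix.toLin'_apply]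

/-- **`Q′G′·R = 0`** (`Ran R ⊂ Δ′_aN(Q′)`, the subspace onto which [4] (3.21)–(3.25) / [B5] p. 25 project: «It is an orthogonal
projection on the linear subspace ΔN(Q′_k)»), from the inverse identity `(Q′G′²Q′*)·G = 1`. [cite: Balaban1984PropagatorsI, p.25; Balaban1985BackgroundPropagators, (3.21)–(3.25) p.394; Balaban1985RegularSpaces, (1.27) p.80] -/
theorem QB_gml_rProjML {G : Module.End ℝ (↥(bset D) → ℝ)} (hG : kerOp (W D) (Xk D a) * G = 1)
    (f : ↥(boxDom (N0 ℓ Mh k P)) → ℝ) :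
    QB D (gml (N0 ℓ Mh k P) ℓ k D.lev a *ᵥ rProjML D a G f) = 0 := by
  have h2 : ∀ v, kerOp (W D) (Xk D a) (G v) = v := fun v => by
    have h := congrArg (fun T : Module.End ℝ (↥(bset D) → ℝ) => T v) hG
    simpa only [Module.End.mul_apply, Module.End.one_apply] using h
  rw [rProjML_apply, Matrix.mulVec_sub, map_sub, QB_gml_gml_QsB, h2, sub_self]

/-- **`R(G′Q′*X) = 0`**: `R` annihilates `Ran(G′Q′*)`, from the inverse identity `G·(Q′G′²Q′*) = 1` (the complement along which
(3.22)'s minimiser is corrected). [cite: Balaban1985BackgroundPropagators, (3.22)–(3.25) p.394] -/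
theorem rProjML_gml_QsB {G : Module.End ℝ (↥(bset D) → ℝ)} (hG : G * kerOp (W D) (Xk D a) = 1)
    (Xc : ↥(bset D) → ℝ) :
    rProjML D a G (gml (N0 ℓ Mh k P) ℓ k D.lev a *ᵥ QsB D Xc) = 0 := by
  have h1 : ∀ v, G (kerOp (W D) (Xk D a) v) = v := fun v => by
    have h := congrArg (fun T : Module.End ℝ (↥(bset D) → ℝ) => T v) hG
    simpa only [Module.End.mul_apply, Module.End.one_apply] using h
  rw [rProjML_apply, QB_gml_gml_QsB, h1, sub_self]

/-- **`R² = R`** (R is a projection; [4] p. 394 / [B5] p. 25 «The projection operator R»), from `Q′G′·R = 0`.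
[cite: Balaban1985BackgroundPropagators, (3.25) p.394; Balaban1984PropagatorsI, p.25] -/
theorem rProjML_idem {G : Module.End ℝ (↥(bset D) → ℝ)} (hG : kerOp (W D) (Xk D a) * G = 1)
    (f : ↥(boxDom (N0 ℓ Mh k P)) → ℝ) :
    rProjML D a G (rProjML D a G f) = rProjML D a G f := by
  conv_lhs => rw [rProjML_apply]
  rw [QB_gml_rProjML hG, map_zero, map_zero, Matrix.mulVec_zero, sub_zero]

/-- **`|Q′g(y)| ≦ M`** when `|g| ≦ M` on the block `B(y)`: the normalised block mean does not increase the sup norm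
(`#B(y) ≤ W(y)`, `card_blkOf_le`). [cite: Balaban1984PropagatorsII, (2.14)–(2.15) p.225] -/
theorem abs_QB_le (g : ↥(boxDom (N0 ℓ Mh k P)) → ℝ) {M : ℝ} (hM : 0 ≤ M) (y : ↥(B6Geom246MultiLevelBoxL0.bset D))
    (hg : ∀ x, blkOf D x = y → |g x| ≤ M) : |QB D g y| ≤ M := by
  have hW := W_pos D y
  rw [QB_apply, abs_mul, abs_of_pos (inv_pos.2 hW)]
  have hsum : |∑ x ∈ Finset.univ.filter (fun x => blkOf D x = y), g x| ≤
      ((Finset.univ.filter fun x : ↥(boxDom (N0 ℓ Mh k P)) => blkOf D x = y).card : ℝ) * M := by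
    refine (Finset.abs_sum_le_sum_abs _ _).trans ?_
    have h : ∀ x ∈ Finset.univ.filter (fun x => blkOf D x = y), |g x| ≤ M :=
      fun x hx => hg x (Finset.mem_filter.1 hx).2
    refine (Finset.sum_le_sum h).trans ?_
    rw [Finset.sum_const, nsmul_eq_mul]
  calc (W D y)⁻¹ * |∑ x ∈ Finset.univ.filter (fun x => blkOf D x = y), g x|
      ≤ (W D y)⁻¹ * (((Finset.univ.filter fun x : ↥(boxDom (N0 ℓ Mh k P)) => blkOf D x = y).card : ℝ) * M) :=
        mul_le_mul_of_nonneg_left hsum (inv_nonneg.2 hW.le)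
    _ ≤ (W D y)⁻¹ * (W D y * M) :=
        mul_le_mul_of_nonneg_left (mul_le_mul_of_nonneg_right (card_blkOf_le D y) hM) (inv_nonneg.2 hW.le)
    _ = M := by rw [← mul_assoc, inv_mul_cancel₀ hW.ne', one_mul]

/-- **«|Rf| ≦ B′₀|f|» (p. 92) AT U₀ = 1 ON THE `k`-LEVEL BOX FAMILY, THE INVERSE ENTERING BY ITS (2.87)-BOUND** — B8 p. 92:
«from Theorems 3.1, 3.2 of [4] it follows that |Rf| ≦ B′₀|f|» (row B8.Claim@92): for every `C₁, δ₁ > 0` there are `B′₀, M₀ > 0`,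
`N₀ ≥ 1` such that under the thresholds and hypotheses of `hPrime_single_decay_of_inverse`, for every fine function `f` with
`|f(z)| ≦ S` and every point `x`: `|(Rf)(x)| ≦ B′₀S` for `R = 1 − G′Q′*GQ′G′` (`rProjML`).  Chain (the multi-level one, every
level weight genuine): `|G′f| ≦ Cc(Lʲ)²S` (Prop. 2.2 + (2.61)), `|Q′G′f(y)| ≦ Cc(Lʲ)²S` (`abs_QB_le`), `|G(Q′G′f)(y)| ≦
C₁CL²c²(Lʲ)⁻²S` ((2.87), the weight `(L^{j′})²` moved by (2.60), summed by (2.61)), `|G′Q′*(…)(x)| ≦ C₁C²L⁴c³S` (Prop. 2.2, the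
weight `(L^{j′})⁻²` moved by (2.60), summed by (2.61)). [cite: Balaban1985RegularSpaces, p.92; Balaban1985BackgroundPropagators, Thm 3.1 (3.42) p.397, Thm 3.2 (3.48) p.398, (3.25) p.394; Balaban1984PropagatorsII, Prop. 2.2 p.234, Prop. 2.3 (2.87) p.238, Lemma 2.1 (2.60)–(2.61) p.234] -/
theorem rProjML_sup_bound_of_inverse (d ℓ : ℕ) (hℓ : 1 ≤ ℓ) (aminus aplus a2minus a2plus : ℝ) (ha : 0 < aminus)
    (ha2 : 0 < a2minus) {C₁ δ₁ : ℝ} (hC₁ : 0 < C₁) (hδ₁ : 0 < δ₁) :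
    ∃ B₀' M₀ : ℝ, ∃ N₀ : ℕ, 0 < B₀' ∧ 0 < M₀ ∧ 0 < N₀ ∧
      ∀ (k Mh R : ℕ), 3 ≤ Mh → M₀ ≤ ((ℓ : ℝ) + 1) * Mh → 2 * (ℓ + 1) ≤ R → N₀ + 1 ≤ R * ((ℓ + 1) * Mh) →
      ∀ (P : Fin (d + 1) → ℕ) (_hP : ∀ μ, 1 ≤ P μ) (D : Domains d ℓ Mh k P R) (a c : ℕ → ℝ),
        (∀ i, aminus ≤ a i ∧ a i ≤ aplus) → (∀ i, a2minus ≤ c i ∧ c i ≤ a2plus) →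
        (∀ i, a (i + 1) = aNext ℓ (a i) (c i)) →
        ∀ G : Module.End ℝ (↥(bset D) → ℝ),
          (∀ y y' : ↥(bset D), |mat G y y' / W D y'| ≤
            C₁ * (geom D).len y ^ (-(4 : ℝ)) * (geom D).len y' ^ (-((d + 1 : ℕ) : ℝ)) *
              Real.exp (-(δ₁ / 2 * (geom D).dist y y'))) →
          ∀ (f : ↥(boxDom (N0 ℓ Mh k P)) → ℝ) (S : ℝ), 0 ≤ S → (∀ z, |f z| ≤ S) →
            ∀ x : ↥(boxDom (N0 ℓ Mh k P)), |rProjML D a G f x| ≤ B₀' * S := by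
  obtain ⟨δ₀, C, M₀, N₀, hδ₀, hC, hM₀, hN₀, h22⟩ :=
    prop22_entries1236_multiLevelBox d ℓ hℓ aminus aplus a2minus a2plus ha ha2
  have hL0 : (0 : ℝ) < (ℓ : ℝ) + 1 := by positivity
  have hL1 : (1 : ℝ) ≤ (ℓ : ℝ) + 1 := by linarith [(Nat.cast_nonneg ℓ : (0 : ℝ) ≤ ℓ)]
  have hlog : Real.log ((ℓ : ℝ) + 1) ≤ (ℓ : ℝ) + 1 := (Real.log_le_sub_one_of_pos hL0).trans (by linarith)
  have hlog0 : 0 ≤ Real.log ((ℓ : ℝ) + 1) := Real.log_nonneg hL1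
  -- the smallest rate `σ = min(δ₀/4, δ₁/4)` and the threshold `N₁`
  obtain ⟨σ, hσ⟩ : ∃ σ : ℝ, σ = min (δ₀ / 4) (δ₁ / 4) := ⟨_, rfl⟩
  have hσ0 : 0 < σ := by rw [hσ]; exact lt_min (by positivity) (by positivity)
  have hσδ₀ : σ ≤ δ₀ / 4 := by rw [hσ]; exact min_le_left _ _
  have hσδ₁ : σ ≤ δ₁ / 4 := by rw [hσ]; exact min_le_right _ _
  obtain ⟨N₁, hN₁⟩ : ∃ N₁ : ℕ, N₁ = ⌈128 * ((d : ℝ) + 1) * ((ℓ : ℝ) + 1) / σ⌉₊ + 1 := ⟨_, rfl⟩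
  have hN₁pos : 0 < N₁ := by rw [hN₁]; omega
  have hN₁gt : 128 * ((d : ℝ) + 1) * ((ℓ : ℝ) + 1) < σ * (N₁ : ℝ) := by
    have h : 128 * ((d : ℝ) + 1) * ((ℓ : ℝ) + 1) / σ < (N₁ : ℝ) := by
      rw [hN₁]; push_cast
      exact lt_of_le_of_lt (Nat.le_ceil _) (by linarith)
    rw [div_lt_iff₀ hσ0] at h
    linarith
  obtain ⟨cK, hcK⟩ : ∃ cK : ℝ, cK = K261 N₁ (d + 1) ((ℓ : ℝ) + 1) 1 (1 * σ) := ⟨_, rfl⟩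
  have hcK0 : 0 ≤ cK := by rw [hcK]; exact K261_nonneg hL0.le zero_le_one
  obtain ⟨B, hB⟩ : ∃ B : ℝ, B = C₁ * C ^ 2 * ((ℓ : ℝ) + 1) ^ 4 * cK ^ 3 := ⟨_, rfl⟩
  have hB0 : 0 ≤ B := by rw [hB]; positivity
  refine ⟨B + 1, M₀, max N₀ N₁, by linarith, hM₀, lt_of_lt_of_le hN₀ (le_max_left _ _), ?_⟩
  intro k Mh R hMh hM hR hRM P hP D a c haw hcw hac G hG f S hS hf x
  have hMh1 : 1 ≤ Mh := le_trans (by norm_num) hMh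
  have hRM0 : N₀ + 1 ≤ R * ((ℓ + 1) * Mh) := le_trans (Nat.succ_le_succ (le_max_left _ _)) hRM
  have hRM1 : N₁ + 1 ≤ R * ((ℓ + 1) * Mh) := le_trans (Nat.succ_le_succ (le_max_right _ _)) hRM
  have hRMone : 1 ≤ R * ((ℓ + 1) * Mh) := le_trans (by omega) hRM1
  obtain ⟨hTG, -, -, -⟩ := h22 k Mh R hMh hM hR hRM0 P hP D a c haw hcw hac
  have hdnn := (triangle_refl_nonneg D hMh1 hP).2.2
  have hlen0 : ∀ y : ↥(bset D), 0 ≤ (geom D).len y := fun y => (len_pos D y).le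
  -- Lemma 2.1 on the box at the rate `σ`, and every larger rate
  have hθ : Real.exp (-(1 * σ)) * ((ℓ : ℝ) + 1) ^ ((2 * (d + 1 : ℕ) : ℝ) / N₁) < 1 := by
    refine theta_lt_one_of_log hL0 hN₁pos ?_
    push_cast
    nlinarith [mul_le_mul_of_nonneg_left hlog (by positivity : (0 : ℝ) ≤ 2 * ((d : ℝ) + 1))]
  obtain ⟨-, h261, -, -⟩ := lemma21_box D hMh1 hP hN₁pos hRM1 hσ0.le (α := 1) zero_le_one le_rfl hθ
  rw [← hcK] at h261
  have hrow : ∀ τ : ℝ, σ ≤ τ → ∀ y : (geom D).Site,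
      ∑ y'' : (geom D).Site, Real.exp (-(τ * (geom D).dist y y'')) ≤ cK := by
    intro τ hτ y
    have h := ineq261With_of_le (g := geom D) h261 (δ' := τ) (α' := 1) (by linarith) hdnn y
    simpa only [one_mul] using h
  -- the threshold `L² ≤ e^{σ(RM−1)}`, hence at the absorption rates `δ₀/4`, `δ₁/4`
  have hthr : ∀ β : ℝ, σ ≤ β → ((ℓ : ℝ) + 1) ^ 2 ≤ Real.exp (β * ((geomB D).R * (geomB D).M)) := by
    intro β hβ
    rw [geomB_RM D hMh1]
    have hge : (N₁ : ℝ) ≤ (R : ℝ) * (((ℓ : ℝ) + 1) * Mh) - 1 := by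
      have : ((N₁ + 1 : ℕ) : ℝ) ≤ ((R * ((ℓ + 1) * Mh) : ℕ) : ℝ) := by exact_mod_cast hRM1
      push_cast at this; linarith
    have h2 : 2 * Real.log ((ℓ : ℝ) + 1) ≤ β * ((R : ℝ) * (((ℓ : ℝ) + 1) * Mh) - 1) := by
      have h1 : σ * (N₁ : ℝ) ≤ β * ((R : ℝ) * (((ℓ : ℝ) + 1) * Mh) - 1) :=
        calc σ * (N₁ : ℝ) ≤ β * (N₁ : ℝ) := mul_le_mul_of_nonneg_right hβ (Nat.cast_nonneg _)
          _ ≤ β * ((R : ℝ) * (((ℓ : ℝ) + 1) * Mh) - 1) := mul_le_mul_of_nonneg_left hge (by linarith)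
      have hd0 : (0 : ℝ) ≤ (d : ℝ) := Nat.cast_nonneg d
      nlinarith
    calc ((ℓ : ℝ) + 1) ^ 2 = Real.exp (2 * Real.log ((ℓ : ℝ) + 1)) := by
          rw [← Real.exp_log (pow_pos hL0 2), Real.log_pow]; norm_num
      _ ≤ _ := Real.exp_le_exp.2 h2
  -- the first-entry majorant with the lengths `(geom D).len`
  have hTG' : HasMajorant (g := geom D) (blkOf D) (Matrix.toLin' (gml (N0 ℓ Mh k P) ℓ k D.lev a))
      (fun y y' => C * (geom D).len y ^ 2 * Real.exp (-(δ₀ / 2 * (geom D).dist y y'))) := by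
    refine hasMajorant_mono (g := geom D) (blkOf D) hTG fun y y' => le_of_eq ?_
    rw [len_eq, ← pow_mul, Nat.mul_comm]
  -- step 1: `|G′f(z)| ≤ C·c·S·(L^{j(z)})²`
  have hp1 : ∀ _y : ↥(bset D), (0 : ℝ) ≤ 1 := fun _ => zero_le_one
  have hGf : ∀ z : ↥(boxDom (N0 ℓ Mh k P)), |(gml (N0 ℓ Mh k P) ℓ k D.lev a *ᵥ f) z| ≤
      C * cK * S * (geom D).len (blkOf D z) ^ 2 := by
    intro z
    have h1 := abs_apply_le_of_levelBound (g := geom D) (blkOf D) hTG' (p := fun _ => (1 : ℝ)) hS hp1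
      (fun z => by rw [mul_one]; exact hf z) z
    rw [Matrix.toLin'_apply] at h1
    refine h1.trans ?_
    have hr := hrow (δ₀ / 2) (by linarith) (blkOf D z)
    have hsum : ∑ b' : (geom D).Site, C * (geom D).len (blkOf D z) ^ 2 *
          Real.exp (-(δ₀ / 2 * (geom D).dist (blkOf D z) b')) * 1
        = C * (geom D).len (blkOf D z) ^ 2 * ∑ b' : (geom D).Site,
            Real.exp (-(δ₀ / 2 * (geom D).dist (blkOf D z) b')) := by
      rw [Finset.mul_sum]
      exact Finset.sum_congr rfl fun b' _ => by ring
    rw [hsum]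
    have hq : 0 ≤ C * (geom D).len (blkOf D z) ^ 2 := mul_nonneg hC.le (pow_nonneg (hlen0 _) 2)
    calc S * (C * (geom D).len (blkOf D z) ^ 2 * ∑ b' : (geom D).Site,
          Real.exp (-(δ₀ / 2 * (geom D).dist (blkOf D z) b')))
        ≤ S * (C * (geom D).len (blkOf D z) ^ 2 * cK) := mul_le_mul_of_nonneg_left (mul_le_mul_of_nonneg_left hr hq) hS
      _ = C * cK * S * (geom D).len (blkOf D z) ^ 2 := by ring
  -- step 2: `|Q′G′f(y)| ≤ C·c·S·(Lʲ)²`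
  have hv : ∀ y : ↥(bset D), |QB D (gml (N0 ℓ Mh k P) ℓ k D.lev a *ᵥ f) y| ≤ C * cK * S * (geom D).len y ^ 2 := by
    intro y
    refine abs_QB_le (D := D) _ (by positivity) y fun z hz => ?_
    rw [← hz]
    exact hGf z
  -- step 3: `|G(Q′G′f)(y)| ≤ C₁·C·L²·c²·S·(Lʲ)⁻²` ((2.87), the weight `(L^{j′})²` moved by (2.60), summed by (2.61))
  have hmat : ∀ y y' : ↥(bset D), |mat G y y'| ≤
      C₁ * ((geom D).len y ^ 4)⁻¹ * Real.exp (-(δ₁ / 2 * (geom D).dist y y')) := by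
    intro y y'
    have h := hG y y'
    have hWpos := W_pos D y'
    have hW : W D y' = (geom D).len y' ^ (d + 1) := rfl
    rw [abs_div, abs_of_pos hWpos, div_le_iff₀ hWpos, rpow_neg_four_eq (len_pos D y),
      rpow_neg_natCast_eq (len_pos D y'), hW] at h
    calc |mat G y y'| ≤ _ := h
      _ = C₁ * ((geom D).len y ^ 4)⁻¹ * Real.exp (-(δ₁ / 2 * (geom D).dist y y')) *
            (((geom D).len y' ^ (d + 1))⁻¹ * (geom D).len y' ^ (d + 1)) := by ring
      _ = C₁ * ((geom D).len y ^ 4)⁻¹ * Real.exp (-(δ₁ / 2 * (geom D).dist y y')) := by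
            rw [inv_mul_cancel₀ (pow_pos (len_pos D y') _).ne', mul_one]
  have hf2 : ∀ y y'' : (geom D).Site, (geom D).len y'' ^ 2 ≤
      ((ℓ : ℝ) + 1) ^ 2 * Real.exp (δ₁ / 4 * (geom D).dist y y'') * (geom D).len y ^ 2 :=
    fun y y'' => pow_len_le hMh1 hP hRMone 2 (by positivity) (hthr (δ₁ / 4) hσδ₁) y y''
  have hGv : ∀ y : ↥(bset D), |G (QB D (gml (N0 ℓ Mh k P) ℓ k D.lev a *ᵥ f)) y| ≤
      C₁ * C * ((ℓ : ℝ) + 1) ^ 2 * cK ^ 2 * S * ((geom D).len y ^ 2)⁻¹ := by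
    intro y
    have hn : 0 ≤ C₁ * ((geom D).len y ^ 4)⁻¹ := mul_nonneg hC₁.le (inv_nonneg.2 (pow_nonneg (hlen0 y) 4))
    have h2 := levelRowSum_le (g := geom D) hdnn (σ := δ₁ / 2) (β := δ₁ / 4) (τ := δ₁ / 4)
      (A := ((ℓ : ℝ) + 1) ^ 2) (c := cK) (by linarith) (by positivity) (f := fun b => (geom D).len b ^ 2)
      (fun b => pow_nonneg (hlen0 b) 2) hf2 (hrow (δ₁ / 4) hσδ₁) y
    have h2' : ∑ y' : ↥(bset D), Real.exp (-(δ₁ / 2 * (geom D).dist y y')) * (geom D).len y' ^ 2 ≤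
        ((ℓ : ℝ) + 1) ^ 2 * cK * (geom D).len y ^ 2 := h2
    rw [apply_eq_sum_mat]
    have hly : 0 < (geom D).len y := len_pos D y
    calc |∑ y' : ↥(bset D), mat G y y' * QB D (gml (N0 ℓ Mh k P) ℓ k D.lev a *ᵥ f) y'|
        ≤ ∑ y' : ↥(bset D), |mat G y y' * QB D (gml (N0 ℓ Mh k P) ℓ k D.lev a *ᵥ f) y'| :=
          Finset.abs_sum_le_sum_abs _ _
      _ ≤ ∑ y' : ↥(bset D), C₁ * ((geom D).len y ^ 4)⁻¹ * Real.exp (-(δ₁ / 2 * (geom D).dist y y')) *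
            (C * cK * S * (geom D).len y' ^ 2) := Finset.sum_le_sum fun y' _ => by
          rw [abs_mul]
          exact mul_le_mul (hmat y y') (hv y') (abs_nonneg _) (mul_nonneg hn (Real.exp_nonneg _))
      _ = C₁ * ((geom D).len y ^ 4)⁻¹ * (C * cK * S) *
            ∑ y' : ↥(bset D), Real.exp (-(δ₁ / 2 * (geom D).dist y y')) * (geom D).len y' ^ 2 := by
          rw [Finset.mul_sum]
          exact Finset.sum_congr rfl fun y' _ => by ring
      _ ≤ C₁ * ((geom D).len y ^ 4)⁻¹ * (C * cK * S) * (((ℓ : ℝ) + 1) ^ 2 * cK * (geom D).len y ^ 2) :=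
          mul_le_mul_of_nonneg_left h2' (mul_nonneg hn (by positivity))
      _ = C₁ * C * ((ℓ : ℝ) + 1) ^ 2 * cK ^ 2 * S * ((geom D).len y ^ 2)⁻¹ := by
          field_simp
  -- step 4: `|G′Q′*(…)(x)| ≤ C₁·C²·L⁴·c³·S` (Prop. 2.2, the weight `(L^{j′})⁻²` moved by (2.60), summed by (2.61))
  have hu : ∀ z : ↥(boxDom (N0 ℓ Mh k P)),
      |QsB D (G (QB D (gml (N0 ℓ Mh k P) ℓ k D.lev a *ᵥ f))) z| ≤
        C₁ * C * ((ℓ : ℝ) + 1) ^ 2 * cK ^ 2 * S * ((geom D).len (blkOf D z) ^ 2)⁻¹ :=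
    fun z => by rw [QsB_apply]; exact hGv _
  have hfi2 : ∀ y y'' : (geom D).Site, ((geom D).len y'' ^ 2)⁻¹ ≤
      ((ℓ : ℝ) + 1) ^ 2 * Real.exp (δ₀ / 4 * (geom D).dist y y'') * ((geom D).len y ^ 2)⁻¹ :=
    fun y y'' => inv_pow_len_le hMh1 hP hRMone 2 (by positivity) (hthr (δ₀ / 4) hσδ₀) y y''
  have hA : 0 ≤ C₁ * C * ((ℓ : ℝ) + 1) ^ 2 * cK ^ 2 * S := by positivity
  have hlast : |(gml (N0 ℓ Mh k P) ℓ k D.lev a *ᵥ QsB D (G (QB D (gml (N0 ℓ Mh k P) ℓ k D.lev a *ᵥ f)))) x|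
      ≤ B * S := by
    have h1 := abs_apply_le_of_levelBound (g := geom D) (blkOf D) hTG' (p := fun b => ((geom D).len b ^ 2)⁻¹) hA
      (fun b => inv_nonneg.2 (pow_nonneg (hlen0 b) 2)) hu x
    rw [Matrix.toLin'_apply] at h1
    refine h1.trans ?_
    have h2 := levelRowSum_le (g := geom D) hdnn (σ := δ₀ / 2) (β := δ₀ / 4) (τ := δ₀ / 4)
      (A := ((ℓ : ℝ) + 1) ^ 2) (c := cK) (by linarith) (by positivity) (f := fun b => ((geom D).len b ^ 2)⁻¹)
      (fun b => inv_nonneg.2 (pow_nonneg (hlen0 b) 2)) hfi2 (hrow (δ₀ / 4) hσδ₀) (blkOf D x)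
    have hsum : ∑ b' : (geom D).Site, C * (geom D).len (blkOf D x) ^ 2 *
          Real.exp (-(δ₀ / 2 * (geom D).dist (blkOf D x) b')) * ((geom D).len b' ^ 2)⁻¹
        = C * (geom D).len (blkOf D x) ^ 2 * ∑ b' : (geom D).Site,
            Real.exp (-(δ₀ / 2 * (geom D).dist (blkOf D x) b')) * ((geom D).len b' ^ 2)⁻¹ := by
      rw [Finset.mul_sum]
      exact Finset.sum_congr rfl fun b' _ => by ring
    rw [hsum]
    have hq : 0 ≤ C * (geom D).len (blkOf D x) ^ 2 := mul_nonneg hC.le (pow_nonneg (hlen0 _) 2)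
    have hlx : 0 < (geom D).len (blkOf D x) := len_pos D _
    calc C₁ * C * ((ℓ : ℝ) + 1) ^ 2 * cK ^ 2 * S * (C * (geom D).len (blkOf D x) ^ 2 *
          ∑ b' : (geom D).Site, Real.exp (-(δ₀ / 2 * (geom D).dist (blkOf D x) b')) * ((geom D).len b' ^ 2)⁻¹)
        ≤ C₁ * C * ((ℓ : ℝ) + 1) ^ 2 * cK ^ 2 * S * (C * (geom D).len (blkOf D x) ^ 2 *
          (((ℓ : ℝ) + 1) ^ 2 * cK * ((geom D).len (blkOf D x) ^ 2)⁻¹)) :=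
          mul_le_mul_of_nonneg_left (mul_le_mul_of_nonneg_left h2 hq) hA
      _ = B * S := by
          rw [hB]
          field_simp
  -- `Rf = f − G′Q′*G Q′G′f`
  rw [rProjML_apply, Pi.sub_apply]
  calc |f x - _| ≤ |f x| + |(gml (N0 ℓ Mh k P) ℓ k D.lev a *ᵥ
        QsB D (G (QB D (gml (N0 ℓ Mh k P) ℓ k D.lev a *ᵥ f)))) x| := abs_sub _ _
    _ ≤ S + B * S := add_le_add (hf x) hlast
    _ = (B + 1) * S := by ring

end RProj

end

end Literature.MathematicalPhysics.QuantumFieldTheory.Balaban1983to89.B8Ineq192MultiLevelBoxL0
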